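import Literature.Analysis.PDE.SymmetricHyperbolicDerived
import Mathlib.MeasureTheory.Integral.IntervalIntegral.FundThmCalculus
import Mathlib.Analysis.InnerProductSpace.Calculus
import Mathlib.Analysis.ODE.Gronwall
import Literature.Analysis.PDE.WordEnergySupBound
import Literature.Analysis.PDE.HsEval
import Mathlib.Analysis.Calculus.UniformLimitsDeriv
import Mathlib.Analysis.SpecificLimits.Basic
import Literature.Analysis.PDE.LinearSystemJointSmoothness
import HarnessLib

/-!
# Friedrichs' existence theorem for linear symmetric hyperbolic systems by the energy method (topic `Analysis/PDE`)

For a linear first-order symmetric hyperbolic system `∂ₜU = 𝒫(t)U = Σⱼ Aⱼ(t, x) ∂ⱼU + B(t, x) U` on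
`ℝ × ℝⁿ` with values in a finite-dimensional real inner product space `W`, whose coefficients are a
regular admissible family (`IsRegularSymmCoeffFamily`, `SymmetricHyperbolicDerived.lean`: smooth,
`Aⱼ` pointwise symmetric, all spatial word derivatives bounded locally uniformly in time, jointly
smooth, word derivatives Lipschitz in time), and data `U₀ ∈ C_c^∞(ℝⁿ; W)`, there is a global smooth
solution `U ∈ C^∞(ℝ × ℝⁿ; W)`, `U(0) = U₀` — **`exists_smooth_solution`** (Part 5; Friedrichs 1954,
Thm. 4.1 with §§3–4; Lax 2006, Ch. 6; Taylor, *PDE III*, Ch. 16, §1; Alinhac 2009, §7.6, Thm. 7.11). The proof is Friedrichs'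
energy method on the tree's infrastructure (`SymmetricHyperbolicEnergy/Regularised/Uniqueness`,
`MollifierL2`, `MollifierRate`, `WordEnergySupBound`, `LinearSystemJointSmoothness`): the
regularised equation `Y' = J_ε 𝒫 (ρ_ε ⋆ Y)` on `L²` and the word curves of its solution (Part 1),
a-priori bounds of every order uniform in `ε` (Part 2), the Cauchy property in every Sobolev norm
as `ε → 0` (Part 3), the limit and its spatial regularity by Sobolev embedding and uniform
convergence of derivatives (Part 4), the time derivative, the equation, the data and joint
smoothness (Part 5). It discharges, through `KerrSchild.waveCauchyProblem_of_symmHyperbolic`, the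
named fact `KerrSchild.waveCauchyProblem` (`Literature/Geometry/Lorentzian/KerrSchildWaveCauchyProblemProofs.lean`).
Everything is proved; no named fact and no `sorry` is introduced.

This module has 5 parts, in dependency order.

## Part 1. Friedrichs' method: the regularised solution, its smooth representative, and the word curves (the unmollified word derivatives) with their consistency

Analytic layer of the energy-method existence theory for linear first-order symmetric hyperbolic
systems `∂ₜU = 𝒫(t)U = Σⱼ Aⱼ(t) ∂ⱼU + B(t) U` (Friedrichs 1954), built to discharge the named
fact `Literature.Geometry.Lorentzian.KerrSchild.waveCauchyProblem`. For regular admissible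
coefficients (`IsRegularSymmCoeffFamily`, `SymmetricHyperbolicDerived.lean`), a scale `ε > 0` with
mollifier `ρ = ρ_ε` (`moll`), `J = J_ε` (`mollL2`), and smooth compactly supported data `U₀`:

* `regField`, `exists_regSolution` — the regularised dynamics `Y' = J 𝒫(t) (ρ ⋆ Y)` on
  `L²(ℝⁿ; W)` (the operator `J ∘ derivedOp [] []`, equal to the tree's `regOp`) and its global
  `C¹` solution `Y` with `Y(0) = U₀` (Friedrichs 1954, §3; the tree's linear-growth theorem);
* `smoothSol Y t = ρ ⋆ Y(t)` — the smooth representative `V(t)`, smooth with all word derivatives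
  bounded and square integrable;
* `wordForcing v s = J [∂_v (𝒫(s) V(s))]` — the `L²` element of the mollified word derivative of
  `𝒫V` (through the Leibniz expansion and the derived operators), continuous in `s`, and
  **the word curves** `wordCurve v t = [∂_v U₀] + ∫₀ᵗ wordForcing v` — `C¹` curves in `L²` with
  `wordCurve v' = wordForcing v` (fundamental theorem of calculus for the Bochner integral);
* `convL2_wordCurve` — **consistency**: `J (wordCurve v t) = (∂_vρ) ⋆ Y(t)`, i.e. the word curve is
  the unmollified `v`-th derivative: `ρ ⋆ wordCurve v t = ∂_v V(t)` (both sides are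
  `[∂_v(ρ ⋆ U₀)] + ∫₀ᵗ [∂_v (ρ ⋆ ρ ⋆ 𝒫V)]`, bounded operators commuting with the integral and
  derivatives commuting with mollification).

The point of the word curves (Friedrichs 1954, §4; Taylor, *PDE III*, Ch. 16, (1.11)–(1.13)): the
energy `Σ_v ‖wordCurve v t‖²` has derivative `2 Σ_v ∫⟪∂_vV, ∂_v(𝒫V)⟫` *without commutator
terms*, to which the energy inequality of `SymmetricHyperbolicEnergy.lean` applies; this is carried
out in Part 2 of this module. Everything is proved; no named fact and no `sorry` is
introduced.

## Part 2. Friedrichs' method: the a-priori bounds of every order for the regularised solutions, uniform in the regularisation scale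

Analytic layer of the energy-method existence theory for linear first-order symmetric hyperbolic
systems `∂ₜU = 𝒫(t)U` (Friedrichs 1954), built to discharge the named fact
`Literature.Geometry.Lorentzian.KerrSchild.waveCauchyProblem`. With the word curves of
Part 1 of this module (the unmollified word derivatives `wordCurve v` of the
regularised solution `Y`, `ρ ⋆ wordCurve v t = ∂_v V(t)`, `V = ρ ⋆ Y`), the energy of order `k`

  `e_k(t) = Σ_{|v| ≤ k} ‖wordCurve v t‖²_{L²}`

is differentiable with `e_k' = 2 Σ_v ⟪wordCurve v, wordForcing v⟫ = 2 Σ_v ∫ ⟪∂_vV, ∂_v(𝒫V)⟫`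
(`inner_wordCurve_wordForcing`: the mollifier is self-adjoint on `L²` and moves from the forcing
onto the word curve — Friedrichs' symmetric placement of the mollifiers, so that *no commutator
term appears*), hence `|e_k'| ≤ K e_k` by the energy inequality of every order
(`abs_sum_integral_inner_cwd_foOp_le`, `SymmetricHyperbolicEnergy.lean`) and `ℰ_k(V) ≤ e_k`
(`J` is a contraction). Grönwall's lemma gives the **a-priori bound uniform in `ε`**
(`wordEnergyCurve_le`, `wordEnergy_smoothSol_le_exp`):

  `ℰ_k(V_ε(t)) ≤ e_k(t) ≤ e^{K_T T} ℰ_k(U₀)`,  `|t| ≤ T`,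

with `K_T` depending only on the coefficient bounds of order `k` on `[−T, T]`, the order and the
dimension (Friedrichs 1954, §4; Taylor, *PDE III*, Ch. 16, §1, (1.11)–(1.13); Lax 2006, §6.2).

Everything is proved; no named fact and no `sorry` is introduced.

## Part 3. Friedrichs' method: the regularised solutions are Cauchy in every Sobolev norm as the regularisation scale tends to zero

Analytic layer of the energy-method existence theory for linear first-order symmetric hyperbolic
systems `∂ₜU = 𝒫(t)U` (Friedrichs 1954), built to discharge the named fact
`Literature.Geometry.Lorentzian.KerrSchild.waveCauchyProblem`. For two scales `ε, δ > 0` with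
regularised solutions `Y^ε, Y^δ` of the same `C_c^∞` data `U₀` and smooth representatives
`V^ε = ρ_ε ⋆ Y^ε`, `V^δ = ρ_δ ⋆ Y^δ` (Part 1 of this module), the difference
`D = V^ε − V^δ` satisfies, at every order `k` and uniformly on compact time intervals,

  `Σ_{|v| ≤ k} ‖∂_v D(t)‖₂² ≤ C (ε + δ)²`   (`wordEnergy_diff_le`),

with `C` depending only on the data (through `ℰ_{k+1}(U₀)`, `ℰ_{k+2}(U₀)`), the coefficient bounds
up to order `k + 2` on `[−T, T]`, `k`, the dimension and `T` — not on `ε, δ`.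

Proof (Friedrichs 1954, §4; Taylor, *PDE III*, Ch. 16, §1, (1.14)–(1.15)): the `L²` curves
`J_ε wordCurve^ε v − J_δ wordCurve^δ v`, represented by `∂_vD`, are `C¹` with derivative represented
by `J_ε²∂_v(𝒫V^ε) − J_δ²∂_v(𝒫V^δ) = ∂_v(𝒫D) + ∂_vR`,
`R = (J_ε²𝒫V^ε − 𝒫V^ε) − (J_δ²𝒫V^δ − 𝒫V^δ)`; the energy `d = Σ_v ‖∂_vD‖₂²` therefore has
`d' = 2Σ_v ∫⟪∂_vD, ∂_v𝒫D⟫ + 2Σ_v∫⟪∂_vD, ∂_vR⟫ ≤ K d + 2 N b √d` with `‖∂_vR‖₂ ≤ b = C'(ε + δ)` by the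
rate of mollification `‖J g − g‖₂ ≤ ε Σⱼ‖∂ⱼg‖₂` (`MollifierRate.lean`) applied to `g = ∂_v 𝒫V` and
the a-priori bound of order `k + 2` (Part 2 of this module); Grönwall's inequality with
the forcing `(ε + δ)²` and `d(0) = Σ_v ‖J_ε∂_vU₀ − J_δ∂_vU₀‖₂² ≤ C''(ε + δ)²` give the claim.

Everything is proved; no named fact and no `sorry` is introduced.

## Part 4. Friedrichs' method: the limit of the regularised solutions and its spatial regularity

Analytic layer of the energy-method existence theory for linear first-order symmetric hyperbolic
systems `∂ₜU = 𝒫(t)U` (Friedrichs 1954), built to discharge the named fact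
`Literature.Geometry.Lorentzian.KerrSchild.waveCauchyProblem`. Along the scales `ε_m = 1/(m+1)`
the regularised solutions `V_m = ρ_{ε_m} ⋆ Y_m` (`approx`; Part 1 of this module)
of the data `U₀ ∈ C_c^∞` satisfy, for every word `w` and every compact time interval,

* uniform sup bounds `‖∂_w V_m(t)(x)‖ ≤ C` (`exists_norm_cwd_approx_le`: the Sobolev sup bound
  `‖f‖_∞² ≤ C ℰ_{2(n+1)}(f)` of `WordEnergySupBound.lean` and the a-priori bounds of
  Part 2 of this module), and
* uniform Cauchy bounds `‖∂_w V_m(t)(x) − ∂_w V_{m'}(t)(x)‖ ≤ C (ε_m + ε_{m'})`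
  (`exists_norm_cwd_approx_sub_le`: the same sup bound and the Cauchy estimate of
  Part 3 of this module);

hence every `∂_w V_m` converges, uniformly on `[−T, T] × ℝⁿ` with rate `ε_m`, to a continuous
limit `limField w` (`norm_cwd_approx_sub_limField_le`, `continuous_limField`), the limits are the
word derivatives of the limit `U(t) = limField [] t` of the solutions, which is smooth in space
(`hasFDerivAt_limField`, `contDiff_limField`, `cwd_limField_nil`) with all word derivatives bounded
uniformly on compact time intervals. The time derivative, the equation and the joint smoothness
are derived in Part 5 of this module.

Everything is proved; no named fact and no `sorry` is introduced.

## Part 5. Friedrichs' existence theorem for linear symmetric hyperbolic systems: the time derivative of the limit, the equation, joint smoothness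

Final analytic layer of the energy-method existence theory for linear first-order symmetric
hyperbolic systems `∂ₜU = 𝒫(t)U = Σⱼ Aⱼ(t)∂ⱼU + B(t)U` (Friedrichs 1954), built to discharge the
named fact `Literature.Geometry.Lorentzian.KerrSchild.waveCauchyProblem`. With the limit fields
`limField w` of Part 4 of this module (uniform limits, with rate `ε_m`, of the word
derivatives `∂_w V_m` of the regularised solutions; `U(t) = limField [] t` is smooth in space with
`∂_w U(t) = limField w t`):

* `hasDerivAt_cwd_approx` — `∂ₜ ∂_wV_m(t)(x) = J_m² ∂_w(𝒫(t)V_m(t))(x)` (the regularised equation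
  differentiated in space);
* `exists_norm_deriv_approx_sub_le` — `J_m²∂_w(𝒫V_m) → ∂_w(𝒫U)` uniformly on `[−T, T]` for fixed
  `x` (uniform convergence of all `∂_uV_m`, coefficient bounds, and `‖J²g − g‖_∞ ≤ 2ε‖∇g‖_∞`);
* `hasDerivAt_limField` — hence `∂ₜ ∂_wU = ∂_w(𝒫U)` pointwise (uniform limits of derivatives), in
  particular **`U` solves `∂ₜU = 𝒫(t)U`**, and `U(0) = U₀` (`limField_nil_zero`);
* `exists_smooth_solution` — **Friedrichs' theorem**: for regular admissible coefficients and
  `U₀ ∈ C_c^∞(ℝⁿ; W)` there is `U ∈ C^∞(ℝ × ℝⁿ; W)` with `U(0) = U₀` and `∂ₜU = 𝒫(t)U` on all of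
  `ℝ × ℝⁿ` (joint smoothness by the bootstrap `contDiff_uncurry_of_classical` of
  `LinearSystemJointSmoothness.lean`).

Everything is proved; no named fact and no `sorry` is introduced.

## References

* K. O. Friedrichs, *Symmetric hyperbolic linear differential equations*, Comm. Pure Appl. Math.
  7 (1954) 345–392, §§3–4. [Friedrichs1954]
* M. E. Taylor, *Partial Differential Equations III*, 2nd ed., Springer 2011, Ch. 16, §1.
  [TaylorPDEIII2011]
* P. D. Lax, *Hyperbolic Partial Differential Equations*, AMS 2006, §6.2. [Lax2006]
* S. Alinhac, *Hyperbolic Partial Differential Equations*, Springer 2009, §7.6, Thm. 7.11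
  (existence of smooth solutions of symmetric hyperbolic systems by smoothing operators; held,
  locator verified). [Alinhac2009]
-/

noncomputable section

open MeasureTheory Set Function Filter Metric ContinuousLinearMap intervalIntegral
open scoped ContDiff Topology RealInnerProductSpace ENNReal NNReal Convolution

namespace Literature.Analysis.PDE

open Literature.Analysis.FunctionSpaces Literature.Analysis.ODE

variable {ι : Type*} [Fintype ι]
variable {W : Type*} [NormedAddCommGroup W] [InnerProductSpace ℝ W] [CompleteSpace W]
variable {A : ι → ℝ → EuclideanSpace ℝ ι → (W →L[ℝ] W)} {B : ℝ → EuclideanSpace ℝ ι → (W →L[ℝ] W)}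

/-! ### Representatives of finite sums in `L²` -/

omit [InnerProductSpace ℝ W] [CompleteSpace W] in
/-- The representative of a sum over a list of `L²` elements is a.e. the sum of the representatives.
[folklore] -/
theorem coeFn_list_sum [NormedSpace ℝ W] {α : Type*} (l : List α)
    (F : α → Lp W 2 (volume : Measure (EuclideanSpace ℝ ι))) :
    ((l.map F).sum : EuclideanSpace ℝ ι → W) =ᵐ[(volume : Measure (EuclideanSpace ℝ ι))]
      fun x ↦ (l.map fun a ↦ (F a : EuclideanSpace ℝ ι → W) x).sum := by
  induction l with
  | nil =>
    filter_upwards [Lp.coeFn_zero W 2 (volume : Measure (EuclideanSpace ℝ ι))] with x hx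
    simp only [List.map_nil, List.sum_nil]
    exact hx
  | cons a l ih =>
    rw [List.map_cons, List.sum_cons]
    filter_upwards [Lp.coeFn_add (F a) (l.map F).sum, ih] with x hx hx'
    rw [hx, Pi.add_apply, hx', List.map_cons, List.sum_cons]

section Setup

variable (h : IsRegularSymmCoeffFamily A B) {ε : ℝ} (hε : 0 < ε)

/-! ### The regularised dynamics -/

/-- **The regularised vector field** `Y ↦ J_ε 𝒫(t) (ρ_ε ⋆ Y)` on `L²(ℝⁿ; W)` (Friedrichs'
regularisation with the mollifiers placed symmetrically; the tree's `regOp`, written through the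
derived operator of the empty splitting). [cite: Friedrichs1954, §3] -/
def regField (t : ℝ) :
    Lp W 2 (volume : Measure (EuclideanSpace ℝ ι)) →L[ℝ] Lp W 2 (volume : Measure (EuclideanSpace ℝ ι)) :=
  (mollL2 hε).comp (derivedOp h (contDiff_moll hε) (hasCompactSupport_moll hε) [] [] t)

/-- **Global solvability of the regularised equation**: for every `U₀ ∈ L²` there is a global
`C¹` curve `Y : ℝ → L²` with `Y(0) = U₀` and `Y' = J_ε 𝒫(t) (ρ_ε ⋆ Y)`.
[cite: Friedrichs1954, §3] -/
theorem exists_regSolution (U₀ : Lp W 2 (volume : Measure (EuclideanSpace ℝ ι))) :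
    ∃ Y : ℝ → Lp W 2 (volume : Measure (EuclideanSpace ℝ ι)),
      Y 0 = U₀ ∧ ∀ t, HasDerivAt Y (regField h hε t (Y t)) t := by
  refine exists_solution_of_linearGrowth (v := fun t U ↦ regField h hε t U) (fun T ↦ ?_) (fun U ↦ ?_) U₀
  · obtain ⟨Λ, hΛ0, hΛ⟩ := exists_norm_derivedOp_le h (contDiff_moll hε) (hasCompactSupport_moll hε) T 0 []
    refine ⟨⟨Λ, hΛ0⟩, fun t ht ↦ ⟨LipschitzWith.of_dist_le_mul fun U V ↦ ?_, fun U ↦ ?_⟩⟩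
    · rw [dist_eq_norm, dist_eq_norm, ← map_sub, regField, ContinuousLinearMap.comp_apply]
      exact (norm_mollL2_le hε _).trans (hΛ t ht [] le_rfl _)
    · rw [regField, ContinuousLinearMap.comp_apply]
      exact (norm_mollL2_le hε _).trans (hΛ t ht [] le_rfl _)
  · exact (mollL2 hε).continuous.comp
      (continuous_derivedOp_apply h (contDiff_moll hε) (hasCompactSupport_moll hε) [] [] continuous_const)

omit [CompleteSpace W] in
/-- A solution of the regularised equation is continuous. [folklore] -/
theorem continuous_of_regSolution {Y : ℝ → Lp W 2 (volume : Measure (EuclideanSpace ℝ ι))}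
    (hY : ∀ t, HasDerivAt Y (regField h hε t (Y t)) t) : Continuous Y :=
  continuous_iff_continuousAt.2 fun t ↦ (hY t).continuousAt

omit [CompleteSpace W] in
/-- Along a solution the regularised vector field is continuous in time. [folklore] -/
theorem continuous_regField_apply {Y : ℝ → Lp W 2 (volume : Measure (EuclideanSpace ℝ ι))}
    (hY : ∀ t, HasDerivAt Y (regField h hε t (Y t)) t) : Continuous fun t ↦ regField h hε t (Y t) :=
  (mollL2 hε).continuous.comp (continuous_derivedOp_apply h (contDiff_moll hε)
    (hasCompactSupport_moll hε) [] [] (continuous_of_regSolution h hε hY))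

/-! ### The smooth representative of the solution -/

/-- **The smooth representative** `V(t) = ρ_ε ⋆ Y(t)` of a curve in `L²`. [cite: Friedrichs1954, §3] -/
def smoothSol (Y : ℝ → Lp W 2 (volume : Measure (EuclideanSpace ℝ ι))) (t : ℝ) : EuclideanSpace ℝ ι → W :=
  smoothRep (moll ι hε) (Y t)

omit [CompleteSpace W] in
/-- Unfolding of `smoothSol`. [cite: Friedrichs1954, §3] -/
theorem smoothSol_def (Y : ℝ → Lp W 2 (volume : Measure (EuclideanSpace ℝ ι))) (t : ℝ) :
    smoothSol hε Y t = moll ι hε ⋆[lsmul ℝ ℝ, volume] (Y t : EuclideanSpace ℝ ι → W) := rfl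

omit [CompleteSpace W] in
/-- The smooth representative is smooth. [cite: Friedrichs1954, §3] -/
theorem contDiff_smoothSol (Y : ℝ → Lp W 2 (volume : Measure (EuclideanSpace ℝ ι))) (t : ℝ) :
    ContDiff ℝ ∞ (smoothSol hε Y t) :=
  contDiff_smoothRep (contDiff_moll hε) (hasCompactSupport_moll hε) _

omit [CompleteSpace W] in
/-- The smooth representative is `H^k`-smooth of every order. [cite: Friedrichs1954, §3] -/
theorem isHkSmooth_smoothSol (Y : ℝ → Lp W 2 (volume : Measure (EuclideanSpace ℝ ι))) (t : ℝ) (k : ℕ) :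
    IsHkSmooth k (smoothSol hε Y t) :=
  isHkSmooth_smoothRep (contDiff_moll hε) (hasCompactSupport_moll hε) _ k

omit [CompleteSpace W] in
include h in
/-- `𝒫(s) V(s)` is smooth. [cite: Friedrichs1954, §3] -/
theorem contDiff_foOp_smoothSol (Y : ℝ → Lp W 2 (volume : Measure (EuclideanSpace ℝ ι))) (s : ℝ) :
    ContDiff ℝ ∞ (foOp (fun j ↦ A j s) (B s) (smoothSol hε Y s)) := by
  have hV := contDiff_smoothSol hε Y s
  refine (ContDiff.sum fun j _ ↦ (h.contDiff_A j s).clm_apply ?_).add ((h.contDiff_B s).clm_apply hV)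
  exact (hV.fderiv_right (m := ∞) le_rfl).clm_apply contDiff_const

/-! ### The word forcing -/

/-- **The word forcing** `J_ε [∂_v (𝒫(s) V(s))] ∈ L²`, written through the Leibniz expansion and the
derived operators: `J (Σ_{(a,c) ∈ splittings v} derivedOp a c s (Y s))`. [cite: Friedrichs1954, §4] -/
def wordForcing (Y : ℝ → Lp W 2 (volume : Measure (EuclideanSpace ℝ ι))) (v : List ι) (s : ℝ) :
    Lp W 2 (volume : Measure (EuclideanSpace ℝ ι)) :=
  mollL2 hε (((splittings v).map fun p ↦
    derivedOp h (contDiff_moll hε) (hasCompactSupport_moll hε) p.1 p.2 s (Y s)).sum)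

omit [CompleteSpace W] in
/-- The word forcing of the empty word is the regularised vector field. [cite: Friedrichs1954, §4] -/
theorem wordForcing_nil (Y : ℝ → Lp W 2 (volume : Measure (EuclideanSpace ℝ ι))) (s : ℝ) :
    wordForcing h hε Y [] s = regField h hε s (Y s) := by
  simp [wordForcing, regField]

omit [CompleteSpace W] in
/-- The word forcing is continuous in time along a continuous curve. [cite: Friedrichs1954, §4] -/
theorem continuous_wordForcing {Y : ℝ → Lp W 2 (volume : Measure (EuclideanSpace ℝ ι))}
    (hYc : Continuous Y) (v : List ι) : Continuous (wordForcing h hε Y v) := by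
  refine (mollL2 hε).continuous.comp ?_
  induction splittings v with
  | nil => simpa using continuous_const
  | cons p l ih =>
    simp only [List.map_cons, List.sum_cons]
    exact (continuous_derivedOp_apply h (contDiff_moll hε) (hasCompactSupport_moll hε) p.1 p.2 hYc).add ih

omit [CompleteSpace W] in
/-- The inner sum of the word forcing is represented by `∂_v (𝒫(s) V(s))` almost everywhere
(the Leibniz expansion `cwd_foOp`). [cite: Friedrichs1954, §4] -/
theorem coeFn_wordForcing_inner (Y : ℝ → Lp W 2 (volume : Measure (EuclideanSpace ℝ ι))) (v : List ι) (s : ℝ) :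
    ((((splittings v).map fun p ↦
        derivedOp h (contDiff_moll hε) (hasCompactSupport_moll hε) p.1 p.2 s (Y s)).sum :
          Lp W 2 (volume : Measure (EuclideanSpace ℝ ι))) : EuclideanSpace ℝ ι → W)
      =ᵐ[(volume : Measure (EuclideanSpace ℝ ι))]
        cwd v (foOp (fun j ↦ A j s) (B s) (smoothSol hε Y s)) := by
  rw [cwd_foOp (fun j ↦ h.contDiff_A j s) (h.contDiff_B s) (contDiff_smoothSol hε Y s) v]
  -- a.e. equality term by term over the list of splittings
  have hterm : ∀ p : List ι × List ι,
      ((derivedOp h (contDiff_moll hε) (hasCompactSupport_moll hε) p.1 p.2 s (Y s) :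
        Lp W 2 (volume : Measure (EuclideanSpace ℝ ι))) : EuclideanSpace ℝ ι → W)
        =ᵐ[(volume : Measure (EuclideanSpace ℝ ι))]
        foOp (fun j ↦ cwd p.1 (A j s)) (cwd p.1 (B s)) (cwd p.2 (smoothSol hε Y s)) := fun p ↦
    coeFn_derivedOp h (contDiff_moll hε) (hasCompactSupport_moll hε) p.1 p.2 s (Y s)
  have hall : ∀ᵐ x ∂(volume : Measure (EuclideanSpace ℝ ι)), ∀ p ∈ splittings v,
      ((derivedOp h (contDiff_moll hε) (hasCompactSupport_moll hε) p.1 p.2 s (Y s) :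
        Lp W 2 (volume : Measure (EuclideanSpace ℝ ι))) : EuclideanSpace ℝ ι → W) x =
        foOp (fun j ↦ cwd p.1 (A j s)) (cwd p.1 (B s)) (cwd p.2 (smoothSol hε Y s)) x :=
    (ae_ball_iff (splittings v).finite_toSet.countable).2 fun p _ ↦ hterm p
  filter_upwards [coeFn_list_sum (splittings v) (fun p ↦
    derivedOp h (contDiff_moll hε) (hasCompactSupport_moll hε) p.1 p.2 s (Y s)), hall] with x hx hx'
  rw [hx]
  exact congrArg List.sum (List.map_congr_left fun p hp ↦ hx' p hp)

omit [CompleteSpace W] in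
/-- **The word forcing is represented by the mollified word derivative of `𝒫V`**:
`⇑(wordForcing v s) = ρ ⋆ ∂_v (𝒫(s) V(s))` almost everywhere. [cite: Friedrichs1954, §4] -/
theorem coeFn_wordForcing (Y : ℝ → Lp W 2 (volume : Measure (EuclideanSpace ℝ ι))) (v : List ι) (s : ℝ) :
    (wordForcing h hε Y v s : EuclideanSpace ℝ ι → W) =ᵐ[(volume : Measure (EuclideanSpace ℝ ι))]
      moll ι hε ⋆[lsmul ℝ ℝ, volume] cwd v (foOp (fun j ↦ A j s) (B s) (smoothSol hε Y s)) := by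
  rw [wordForcing, mollL2, ← convolution_kernel_congr_ae (coeFn_wordForcing_inner h hε Y v s)]
  exact coeFn_convL2 _ _ _

omit [CompleteSpace W] in
/-- The regularised vector field along the solution is represented by `ρ ⋆ 𝒫(s) V(s)` almost
everywhere. [cite: Friedrichs1954, §3] -/
theorem coeFn_regField_apply (Y : ℝ → Lp W 2 (volume : Measure (EuclideanSpace ℝ ι))) (s : ℝ) :
    (regField h hε s (Y s) : EuclideanSpace ℝ ι → W) =ᵐ[(volume : Measure (EuclideanSpace ℝ ι))]
      moll ι hε ⋆[lsmul ℝ ℝ, volume] foOp (fun j ↦ A j s) (B s) (smoothSol hε Y s) := by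
  have h1 := coeFn_wordForcing h hε Y [] s
  rw [wordForcing_nil] at h1
  simpa using h1

/-! ### The word curves -/

variable {U₀ : EuclideanSpace ℝ ι → W} (hU₀ : ContDiff ℝ ∞ U₀) (hU₀c : HasCompactSupport U₀)

omit [InnerProductSpace ℝ W] [CompleteSpace W] in
/-- Word derivatives of `C_c^∞` data are square integrable. [folklore] -/
theorem memLp_cwd_data [NormedSpace ℝ W] {U₀ : EuclideanSpace ℝ ι → W} (hU₀ : ContDiff ℝ ∞ U₀)
    (hU₀c : HasCompactSupport U₀) (v : List ι) :
    MemLp (cwd v U₀) 2 (volume : Measure (EuclideanSpace ℝ ι)) :=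
  (continuous_cwd hU₀ v).memLp_of_hasCompactSupport (hasCompactSupport_cwd hU₀c v)

/-- **The word curve** `[∂_v U₀] + ∫₀ᵗ wordForcing v ∈ L²`: the unmollified `v`-th derivative of the
regularised solution. [cite: Friedrichs1954, §4] -/
def wordCurve (Y : ℝ → Lp W 2 (volume : Measure (EuclideanSpace ℝ ι))) (v : List ι) (t : ℝ) :
    Lp W 2 (volume : Measure (EuclideanSpace ℝ ι)) :=
  (memLp_cwd_data hU₀ hU₀c v).toLp (cwd v U₀) + ∫ s in (0 : ℝ)..t, wordForcing h hε Y v s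

omit [CompleteSpace W] in
/-- The word curve at time `0` is `[∂_v U₀]`. [cite: Friedrichs1954, §4] -/
theorem wordCurve_zero (Y : ℝ → Lp W 2 (volume : Measure (EuclideanSpace ℝ ι))) (v : List ι) :
    wordCurve h hε hU₀ hU₀c Y v 0 = (memLp_cwd_data hU₀ hU₀c v).toLp (cwd v U₀) := by
  simp [wordCurve]

/-- **The word curves are `C¹` with derivative the word forcing** (fundamental theorem of calculus
for the Bochner integral of a continuous integrand). [cite: Friedrichs1954, §4] -/
theorem hasDerivAt_wordCurve {Y : ℝ → Lp W 2 (volume : Measure (EuclideanSpace ℝ ι))} (hYc : Continuous Y)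
    (v : List ι) (t : ℝ) :
    HasDerivAt (wordCurve h hε hU₀ hU₀c Y v) (wordForcing h hε Y v t) t := by
  have hc := continuous_wordForcing h hε hYc v
  have hint : IntervalIntegrable (wordForcing h hε Y v) volume 0 t := hc.intervalIntegrable _ _
  have hd := integral_hasDerivAt_right hint (hc.stronglyMeasurableAtFilter _ _) hc.continuousAt
  show HasDerivAt (fun t ↦ (memLp_cwd_data hU₀ hU₀c v).toLp (cwd v U₀) +
    ∫ s in (0 : ℝ)..t, wordForcing h hε Y v s) _ t
  exact hd.const_add _

/-- The word curves are continuous. [folklore] -/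
theorem continuous_wordCurve {Y : ℝ → Lp W 2 (volume : Measure (EuclideanSpace ℝ ι))} (hYc : Continuous Y)
    (v : List ι) : Continuous (wordCurve h hε hU₀ hU₀c Y v) :=
  continuous_iff_continuousAt.2 fun t ↦ (hasDerivAt_wordCurve h hε hU₀ hU₀c hYc v t).continuousAt

/-! ### Consistency: `J (wordCurve v t) = (∂_vρ) ⋆ Y(t)` -/

omit [CompleteSpace W] in
/-- The integrands agree: `J (wordForcing v s) = (∂_vρ) ⋆ (J 𝒫(s) (ρ ⋆ Y s))` in `L²` (derivatives
commute with mollification of smooth fields and fall on the kernel otherwise).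
[cite: Friedrichs1954, §4] -/
theorem mollL2_wordForcing_eq (Y : ℝ → Lp W 2 (volume : Measure (EuclideanSpace ℝ ι))) (v : List ι) (s : ℝ) :
    mollL2 hε (wordForcing h hε Y v s) =
      convL2 (cwd v (moll ι hε)) (contDiff_cwd (contDiff_moll hε) v).continuous
        (hasCompactSupport_cwd (hasCompactSupport_moll hε) v) (regField h hε s (Y s)) := by
  set ρ := moll ι hε with hρdef
  have hρ : ContDiff ℝ ∞ ρ := contDiff_moll hε
  have hρc : HasCompactSupport ρ := hasCompactSupport_moll hε
  set P := foOp (fun j ↦ A j s) (B s) (smoothSol hε Y s) with hP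
  have hPs : ContDiff ℝ ∞ P := contDiff_foOp_smoothSol h hε Y s
  have hPl : LocallyIntegrable P (volume : Measure (EuclideanSpace ℝ ι)) := hPs.continuous.locallyIntegrable
  have hρP : ContDiff ℝ ∞ (ρ ⋆[lsmul ℝ ℝ, volume] P) := contDiff_convolution_kernel hρ hρc hPl
  refine Lp.ext ?_
  have h1 := coeFn_convL2 (continuous_moll hε) hρc (wordForcing h hε Y v s) (W := W)
  have h2 := coeFn_convL2 (contDiff_cwd hρ v).continuous (hasCompactSupport_cwd hρc v)
    (regField h hε s (Y s)) (W := W)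
  rw [mollL2]
  filter_upwards [h1, h2] with x hx1 hx2
  rw [hx1, hx2, convolution_kernel_congr_ae (coeFn_wordForcing h hε Y v s),
    convolution_kernel_congr_ae (coeFn_regField_apply h hε Y s), ← hρdef, ← hP]
  rw [← cwd_convolution_eq_convolution_cwd_kernel hρ hρc (hρP.continuous.locallyIntegrable) v,
    cwd_convolution_eq_convolution_cwd (continuous_moll hε) hρc hρP v,
    cwd_convolution_eq_convolution_cwd (continuous_moll hε) hρc hPs v]

omit [CompleteSpace W] in
/-- The initial values agree: `J [∂_v U₀] = (∂_vρ) ⋆ [U₀]` in `L²`. [cite: Friedrichs1954, §4] -/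
theorem mollL2_toLp_cwd_eq (v : List ι) :
    mollL2 hε ((memLp_cwd_data hU₀ hU₀c v).toLp (cwd v U₀)) =
      convL2 (cwd v (moll ι hε)) (contDiff_cwd (contDiff_moll hε) v).continuous
        (hasCompactSupport_cwd (hasCompactSupport_moll hε) v)
        ((hU₀.continuous.memLp_of_hasCompactSupport hU₀c).toLp U₀) := by
  set ρ := moll ι hε with hρdef
  have hρ : ContDiff ℝ ∞ ρ := contDiff_moll hε
  have hρc : HasCompactSupport ρ := hasCompactSupport_moll hε
  refine Lp.ext ?_
  have h1 := coeFn_convL2 (continuous_moll hε) hρc ((memLp_cwd_data hU₀ hU₀c v).toLp (cwd v U₀)) (W := W)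
  have h2 := coeFn_convL2 (contDiff_cwd hρ v).continuous (hasCompactSupport_cwd hρc v)
    ((hU₀.continuous.memLp_of_hasCompactSupport hU₀c).toLp U₀) (W := W)
  rw [mollL2]
  filter_upwards [h1, h2] with x hx1 hx2
  rw [hx1, hx2, convolution_kernel_congr_ae (MemLp.coeFn_toLp _),
    convolution_kernel_congr_ae (MemLp.coeFn_toLp _), ← hρdef,
    ← cwd_convolution_eq_convolution_cwd_kernel hρ hρc (hU₀.continuous.locallyIntegrable) v,
    cwd_convolution_eq_convolution_cwd (continuous_moll hε) hρc hU₀ v]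

/-- **Consistency of the word curves**: `J_ε (wordCurve v t) = (∂_vρ_ε) ⋆ Y(t)` in `L²`, for a
solution `Y` of the regularised equation with `Y(0) = [U₀]` — the word curve is the unmollified
`v`-th derivative of the regularised solution, `ρ ⋆ wordCurve v t = ∂_v (ρ ⋆ Y t)`.
[cite: Friedrichs1954, §4] -/
theorem convL2_wordCurve {Y : ℝ → Lp W 2 (volume : Measure (EuclideanSpace ℝ ι))}
    (hY0 : Y 0 = (hU₀.continuous.memLp_of_hasCompactSupport hU₀c).toLp U₀)
    (hY : ∀ t, HasDerivAt Y (regField h hε t (Y t)) t) (v : List ι) (t : ℝ) :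
    mollL2 hε (wordCurve h hε hU₀ hU₀c Y v t) =
      convL2 (cwd v (moll ι hε)) (contDiff_cwd (contDiff_moll hε) v).continuous
        (hasCompactSupport_cwd (hasCompactSupport_moll hε) v) (Y t) := by
  set K := convL2 (W := W) (cwd v (moll ι hε)) (contDiff_cwd (contDiff_moll hε) v).continuous
    (hasCompactSupport_cwd (hasCompactSupport_moll hε) v) with hK
  have hYc := continuous_of_regSolution h hε hY
  have hFc := continuous_wordForcing h hε hYc v
  have hRc := continuous_regField_apply h hε hY
  -- `Y t = Y 0 + ∫₀ᵗ Y'`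
  have hYint : ∫ s in (0 : ℝ)..t, regField h hε s (Y s) = Y t - Y 0 :=
    integral_eq_sub_of_hasDerivAt (fun s _ ↦ hY s) (hRc.intervalIntegrable _ _)
  have hYt : Y t = Y 0 + ∫ s in (0 : ℝ)..t, regField h hε s (Y s) := by rw [hYint]; abel
  rw [wordCurve, map_add, hYt, map_add, ← (mollL2 hε).intervalIntegral_comp_comm (hFc.intervalIntegrable _ _),
    ← K.intervalIntegral_comp_comm (hRc.intervalIntegrable _ _), hY0, mollL2_toLp_cwd_eq hε hU₀ hU₀c v]
  congr 1
  exact intervalIntegral.integral_congr fun s _ ↦ mollL2_wordForcing_eq h hε Y v s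

/-- **The smooth representative's word derivatives are the mollified word curves**:
`∂_v V(t) = ρ ⋆ ⇑(wordCurve v t)` (everywhere, both sides being continuous).
[cite: Friedrichs1954, §4] -/
theorem cwd_smoothSol_eq {Y : ℝ → Lp W 2 (volume : Measure (EuclideanSpace ℝ ι))}
    (hY0 : Y 0 = (hU₀.continuous.memLp_of_hasCompactSupport hU₀c).toLp U₀)
    (hY : ∀ t, HasDerivAt Y (regField h hε t (Y t)) t) (v : List ι) (t : ℝ) :
    cwd v (smoothSol hε Y t) = smoothRep (moll ι hε) (wordCurve h hε hU₀ hU₀c Y v t) := by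
  have hρ : ContDiff ℝ ∞ (moll ι hε) := contDiff_moll hε
  have hρc : HasCompactSupport (moll ι hε) := hasCompactSupport_moll hε
  have hc := convL2_wordCurve h hε hU₀ hU₀c hY0 hY v t
  rw [mollL2] at hc
  have h1 := coeFn_convL2 (continuous_moll hε) hρc (wordCurve h hε hU₀ hU₀c Y v t) (W := W)
  have h2 := coeFn_convL2 (contDiff_cwd hρ v).continuous (hasCompactSupport_cwd hρc v) (Y t) (W := W)
  rw [hc] at h1
  have hae : smoothRep (moll ι hε) (wordCurve h hε hU₀ hU₀c Y v t)
      =ᵐ[(volume : Measure (EuclideanSpace ℝ ι))] smoothRep (cwd v (moll ι hε)) (Y t) :=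
    h1.symm.trans h2
  have heq := (Continuous.ae_eq_iff_eq (volume : Measure (EuclideanSpace ℝ ι))
    (contDiff_smoothRep hρ hρc _).continuous
    (contDiff_smoothRep (contDiff_cwd hρ v) (hasCompactSupport_cwd hρc v) _).continuous).1 hae
  rw [heq, smoothSol, cwd_smoothRep hρ hρc]

end Setup

end Literature.Analysis.PDE

end

noncomputable section

open MeasureTheory Set Function Filter Metric ContinuousLinearMap intervalIntegral
open scoped ContDiff Topology RealInnerProductSpace ENNReal NNReal Convolution

namespace Literature.Analysis.PDE

open Literature.Analysis.FunctionSpaces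

variable {ι : Type*} [Fintype ι] [DecidableEq ι]
variable {W : Type*} [NormedAddCommGroup W] [InnerProductSpace ℝ W] [CompleteSpace W]
variable {A : ι → ℝ → EuclideanSpace ℝ ι → (W →L[ℝ] W)} {B : ℝ → EuclideanSpace ℝ ι → (W →L[ℝ] W)}

/-! ### Self-adjointness of mollification on `L²` -/

omit [DecidableEq ι] in
/-- **An even kernel gives a self-adjoint convolution operator on `L²(ℝⁿ; W)`**:
`⟪f, ρ ⋆ g⟫ = ⟪ρ ⋆ f, g⟫`. [cite: Friedrichs1954, §3] -/
theorem inner_convL2_comm {ρ : EuclideanSpace ℝ ι → ℝ} (hρ : Continuous ρ) (hρc : HasCompactSupport ρ)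
    (heven : ∀ x, ρ (-x) = ρ x) (f g : Lp W 2 (volume : Measure (EuclideanSpace ℝ ι))) :
    ⟪f, convL2 ρ hρ hρc g⟫ = ⟪convL2 ρ hρ hρc f, g⟫ := by
  rw [L2.inner_def, L2.inner_def]
  have h1 : ∫ x, ⟪(f : EuclideanSpace ℝ ι → W) x, (convL2 ρ hρ hρc g : EuclideanSpace ℝ ι → W) x⟫ =
      ∫ x, ⟪(f : EuclideanSpace ℝ ι → W) x, (ρ ⋆[lsmul ℝ ℝ, volume] (g : EuclideanSpace ℝ ι → W)) x⟫ :=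
    integral_congr_ae (by filter_upwards [coeFn_convL2 hρ hρc g] with x hx; rw [hx])
  have h2 : ∫ x, ⟪(convL2 ρ hρ hρc f : EuclideanSpace ℝ ι → W) x, (g : EuclideanSpace ℝ ι → W) x⟫ =
      ∫ x, ⟪(ρ ⋆[lsmul ℝ ℝ, volume] (f : EuclideanSpace ℝ ι → W)) x, (g : EuclideanSpace ℝ ι → W) x⟫ :=
    integral_congr_ae (by filter_upwards [coeFn_convL2 hρ hρc f] with x hx; rw [hx])
  rw [h1, h2]
  exact integral_inner_convolution_kernel_comm hρ hρc heven (Lp.memLp f) (Lp.memLp g)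

/-! ### A symmetric Grönwall lemma -/

omit [Fintype ι] [DecidableEq ι] in
/-- **Grönwall, forward and backward from `0`**: if `u ≥ 0` is differentiable on `ℝ` with
`|u'| ≤ K u` on `[−T, T]` (`K ≥ 0`) and `u(0) ≤ δ`, then `u(t) ≤ δ e^{K T}` for `|t| ≤ T`. [folklore] -/
theorem le_mul_exp_of_abs_deriv_le {u u' : ℝ → ℝ} {K δ T : ℝ} (hderiv : ∀ s, HasDerivAt u (u' s) s)
    (hbound : ∀ s ∈ Icc (-T) T, |u' s| ≤ K * u s) (hunn : ∀ s, 0 ≤ u s) (hu0 : u 0 ≤ δ) (hK : 0 ≤ K)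
    {t : ℝ} (ht : t ∈ Icc (-T) T) : u t ≤ δ * Real.exp (K * T) := by
  have hcont : Continuous u := continuous_iff_continuousAt.2 fun s ↦ (hderiv s).continuousAt
  have hδ : 0 ≤ δ := (hunn 0).trans hu0
  have hT : 0 ≤ T := by linarith [ht.1, ht.2]
  have hb : ∀ s ∈ Icc (-T) T, ‖u' s‖ ≤ K * ‖u s‖ + 0 := fun s hs ↦ by
    rw [add_zero, Real.norm_eq_abs, Real.norm_eq_abs, abs_of_nonneg (hunn s)]; exact hbound s hs
  have h0 : ‖u 0‖ ≤ δ := by rw [Real.norm_eq_abs, abs_of_nonneg (hunn 0)]; exact hu0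
  have hfwd : ∀ s ∈ Icc 0 T, u s ≤ δ * Real.exp (K * s) := by
    intro s hs
    have hg := norm_le_gronwallBound_of_norm_deriv_right_le (f := u) (f' := u') (a := 0) (b := T)
      hcont.continuousOn (fun x _ ↦ (hderiv x).hasDerivWithinAt) h0
      (fun x hx ↦ hb x ⟨by linarith [hx.1, hT], hx.2.le⟩) s hs
    rw [gronwallBound_ε0, sub_zero] at hg
    exact (le_abs_self _).trans ((Real.norm_eq_abs _).symm.le.trans hg)
  have hbwd : ∀ s ∈ Icc 0 T, u (-s) ≤ δ * Real.exp (K * s) := by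
    intro s hs
    have hd : ∀ x, HasDerivAt (fun s ↦ u (-s)) (-u' (-x)) x := fun x ↦ by
      have h1 := (hderiv (-x)).scomp x (hasDerivAt_neg x)
      exact h1.congr_deriv (neg_one_smul ℝ _)
    have hg := norm_le_gronwallBound_of_norm_deriv_right_le (f := fun s ↦ u (-s)) (f' := fun s ↦ -u' (-s))
      (a := 0) (b := T) (hcont.comp continuous_neg).continuousOn (fun x _ ↦ (hd x).hasDerivWithinAt)
      (by simpa using h0) (fun x hx ↦ by
        rw [norm_neg]; exact hb (-x) ⟨by linarith [hx.2], by linarith [hx.1, hT]⟩) s hs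
    rw [gronwallBound_ε0, sub_zero] at hg
    exact (le_abs_self _).trans ((Real.norm_eq_abs _).symm.le.trans hg)
  have hexp : ∀ s ∈ Icc 0 T, δ * Real.exp (K * s) ≤ δ * Real.exp (K * T) := fun s hs ↦
    mul_le_mul_of_nonneg_left (Real.exp_le_exp.2 (mul_le_mul_of_nonneg_left hs.2 hK)) hδ
  rcases le_or_gt 0 t with ht0 | ht0
  · exact (hfwd t ⟨ht0, ht.2⟩).trans (hexp t ⟨ht0, ht.2⟩)
  · have h1 := hbwd (-t) ⟨by linarith, by linarith [ht.1]⟩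
    rw [neg_neg] at h1
    exact h1.trans (hexp (-t) ⟨by linarith, by linarith [ht.1]⟩)

section APriori

variable (h : IsRegularSymmCoeffFamily A B) {ε : ℝ} (hε : 0 < ε)
variable {U₀ : EuclideanSpace ℝ ι → W} (hU₀ : ContDiff ℝ ∞ U₀) (hU₀c : HasCompactSupport U₀)
variable {Y : ℝ → Lp W 2 (volume : Measure (EuclideanSpace ℝ ι))}
  (hY0 : Y 0 = (hU₀.continuous.memLp_of_hasCompactSupport hU₀c).toLp U₀)
  (hY : ∀ t, HasDerivAt Y (regField h hε t (Y t)) t)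

/-! ### The inner product identity -/

include hY0 hY in
omit [DecidableEq ι] in
/-- **`⟪wordCurve v t, wordForcing v t⟫ = ∫ ⟪∂_v V(t), ∂_v (𝒫(t) V(t))⟫`** — the mollifier of the
forcing is moved onto the word curve (self-adjointness), where it produces `∂_v V` (consistency).
[cite: Friedrichs1954, §4] -/
theorem inner_wordCurve_wordForcing (v : List ι) (t : ℝ) :
    ⟪wordCurve h hε hU₀ hU₀c Y v t, wordForcing h hε Y v t⟫ =
      ∫ x, ⟪cwd v (smoothSol hε Y t) x, cwd v (foOp (fun j ↦ A j t) (B t) (smoothSol hε Y t)) x⟫ := by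
  rw [wordForcing, mollL2, inner_convL2_comm (continuous_moll hε) (hasCompactSupport_moll hε) (moll_neg hε),
    L2.inner_def]
  refine integral_congr_ae ?_
  have h1 := coeFn_convL2 (continuous_moll hε) (hasCompactSupport_moll hε) (wordCurve h hε hU₀ hU₀c Y v t) (W := W)
  have h2 := coeFn_wordForcing_inner h hε Y v t
  filter_upwards [h1, h2] with x hx1 hx2
  rw [hx1, hx2, cwd_smoothSol_eq h hε hU₀ hU₀c hY0 hY v t, smoothRep]

/-! ### The energy of order `k` of the word curves -/

/-- **The energy of order `k`**: `e_k(t) = Σ_{|v| ≤ k} ‖wordCurve v t‖²`. [cite: Friedrichs1954, §4] -/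
def wordEnergyCurve (Y : ℝ → Lp W 2 (volume : Measure (EuclideanSpace ℝ ι))) (k : ℕ) (t : ℝ) : ℝ :=
  ∑ v ∈ wordsLE ι k, ‖wordCurve h hε hU₀ hU₀c Y v t‖ ^ 2

omit [CompleteSpace W] in
/-- `0 ≤ e_k(t)`. [folklore] -/
theorem wordEnergyCurve_nonneg (k : ℕ) (t : ℝ) : 0 ≤ wordEnergyCurve h hε hU₀ hU₀c Y k t :=
  Finset.sum_nonneg fun _ _ ↦ sq_nonneg _

include hY in
/-- **The energy is differentiable** with `e_k' = Σ_v 2 ⟪wordCurve v, wordForcing v⟫`.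
[cite: Friedrichs1954, §4] -/
theorem hasDerivAt_wordEnergyCurve (k : ℕ) (t : ℝ) :
    HasDerivAt (wordEnergyCurve h hε hU₀ hU₀c Y k)
      (∑ v ∈ wordsLE ι k, 2 * ⟪wordCurve h hε hU₀ hU₀c Y v t, wordForcing h hε Y v t⟫) t := by
  have hYc := continuous_of_regSolution h hε hY
  have hv : ∀ v ∈ wordsLE ι k, HasDerivAt (fun s ↦ ‖wordCurve h hε hU₀ hU₀c Y v s‖ ^ 2)
      (2 * ⟪wordCurve h hε hU₀ hU₀c Y v t, wordForcing h hε Y v t⟫) t := fun v _ ↦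
    (hasDerivAt_wordCurve h hε hU₀ hU₀c hYc v t).norm_sq
  have h := HasDerivAt.fun_sum (u := wordsLE ι k) hv
  exact h

omit [CompleteSpace W] in
/-- At `t = 0` the energy is the word energy of the data: `e_k(0) = ℰ_k(U₀)`. [cite: Friedrichs1954, §4] -/
theorem wordEnergyCurve_zero (k : ℕ) : wordEnergyCurve h hε hU₀ hU₀c Y k 0 = wordEnergy k U₀ := by
  unfold wordEnergyCurve wordEnergy
  refine Finset.sum_congr rfl fun v _ ↦ ?_
  rw [wordCurve_zero, Lp.norm_toLp, ← l2norm_def]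

include hY0 hY in
/-- **The word energy of the smooth representative is dominated by the energy of the word curves**:
`ℰ_k(V(t)) ≤ e_k(t)` (`‖∂_vV‖₂ = ‖ρ ⋆ wordCurve v‖₂ ≤ ‖wordCurve v‖₂`). [cite: Friedrichs1954, §4] -/
theorem wordEnergy_smoothSol_le (k : ℕ) (t : ℝ) :
    wordEnergy k (smoothSol hε Y t) ≤ wordEnergyCurve h hε hU₀ hU₀c Y k t := by
  unfold wordEnergy wordEnergyCurve
  refine Finset.sum_le_sum fun v _ ↦ ?_
  have hle : l2norm (cwd v (smoothSol hε Y t)) ≤ ‖wordCurve h hε hU₀ hU₀c Y v t‖ := by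
    rw [cwd_smoothSol_eq h hε hU₀ hU₀c hY0 hY v t,
      ← norm_convL2_eq_l2norm_smoothRep (continuous_moll hε) (hasCompactSupport_moll hε)]
    exact norm_mollL2_le hε _
  exact pow_le_pow_left₀ (l2norm_nonneg _) hle 2

/-- The constant of the differential inequality for the energy of order `k` with coefficient bound
`M`: `K = 2 N_k (n + 1) 2^{k+1} M`. [cite: Friedrichs1954, §4] -/
def energyRate (ι : Type*) [Fintype ι] [DecidableEq ι] (k : ℕ) (M : ℝ) : ℝ :=
  2 * ((wordsLE ι k).card * ((Fintype.card ι + 1) * 2 ^ (k + 1) * M))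

omit [Fintype ι] in
/-- `0 ≤ K` for `0 ≤ M`. [folklore] -/
theorem energyRate_nonneg [Fintype ι] (k : ℕ) {M : ℝ} (hM : 0 ≤ M) : 0 ≤ energyRate ι k M := by
  unfold energyRate; positivity

include hY0 hY in
/-- **The differential inequality** `|e_k'(t)| ≤ K e_k(t)` whenever the frozen coefficients at `t`
are admissible of order `k` with bound `M`, `K = energyRate k M` (the energy inequality of every
order applied to `V(t)`, and `ℰ_k(V) ≤ e_k`). [cite: Friedrichs1954, §4] -/
theorem abs_deriv_wordEnergyCurve_le {k : ℕ} {M : ℝ} {t : ℝ}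
    (hc : IsSymmCoeff k M (fun j ↦ A j t) (B t)) :
    |∑ v ∈ wordsLE ι k, 2 * ⟪wordCurve h hε hU₀ hU₀c Y v t, wordForcing h hε Y v t⟫| ≤
      energyRate ι k M * wordEnergyCurve h hε hU₀ hU₀c Y k t := by
  have hid : ∑ v ∈ wordsLE ι k, 2 * ⟪wordCurve h hε hU₀ hU₀c Y v t, wordForcing h hε Y v t⟫ =
      2 * ∑ v ∈ wordsLE ι k, ∫ x, ⟪cwd v (smoothSol hε Y t) x,
        cwd v (foOp (fun j ↦ A j t) (B t) (smoothSol hε Y t)) x⟫ := by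
    rw [Finset.mul_sum]
    exact Finset.sum_congr rfl fun v _ ↦ by rw [inner_wordCurve_wordForcing h hε hU₀ hU₀c hY0 hY v t]
  rw [hid, abs_mul, abs_two, energyRate, mul_assoc]
  refine mul_le_mul_of_nonneg_left ?_ zero_le_two
  have hE := abs_sum_integral_inner_cwd_foOp_le hc (isHkSmooth_smoothSol hε Y t (k + 1))
  refine hE.trans (mul_le_mul_of_nonneg_left (wordEnergy_smoothSol_le h hε hU₀ hU₀c hY0 hY k t) ?_)
  have hM : 0 ≤ M := hc.nonneg
  positivity

/-! ### Grönwall: the a-priori bound uniform in `ε` -/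

include hY0 hY in
/-- **The a-priori bound of order `k`, uniform in the regularisation scale**: for `|t| ≤ T`,
`e_k(t) ≤ e^{K T} ℰ_k(U₀)` with `K = energyRate k M_T`, `M_T` the coefficient bound of order `k` on
`[−T, T]` (Grönwall's lemma for `|e'| ≤ K e`, forward and backward from `t = 0`).
[cite: Friedrichs1954, §4] -/
theorem wordEnergyCurve_le {T : ℝ} {k : ℕ} {M : ℝ} (hM : ∀ t ∈ Icc (-T) T, IsSymmCoeff k M (fun j ↦ A j t) (B t))
    {t : ℝ} (ht : t ∈ Icc (-T) T) :
    wordEnergyCurve h hε hU₀ hU₀c Y k t ≤ Real.exp (energyRate ι k M * T) * wordEnergy k U₀ := by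
  have hT : 0 ≤ T := by linarith [ht.1, ht.2]
  have hMnn : 0 ≤ M := (hM 0 ⟨by linarith, hT⟩).nonneg
  have hK0 : 0 ≤ energyRate ι k M := energyRate_nonneg k hMnn
  have h := le_mul_exp_of_abs_deriv_le (fun s ↦ hasDerivAt_wordEnergyCurve h hε hU₀ hU₀c hY k s)
    (fun s hs ↦ abs_deriv_wordEnergyCurve_le h hε hU₀ hU₀c hY0 hY (hM s hs))
    (fun s ↦ wordEnergyCurve_nonneg h hε hU₀ hU₀c k s) (le_of_eq (wordEnergyCurve_zero h hε hU₀ hU₀c k)) hK0 ht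
  rw [mul_comm]
  exact h

include hY0 hY in
/-- **The a-priori bound for a single word curve**: `‖wordCurve v t‖² ≤ e^{K T} ℰ_k(U₀)` for
`|v| ≤ k`, `|t| ≤ T`. [cite: Friedrichs1954, §4] -/
theorem norm_wordCurve_sq_le {T : ℝ} {k : ℕ} {M : ℝ} (hM : ∀ t ∈ Icc (-T) T, IsSymmCoeff k M (fun j ↦ A j t) (B t))
    {t : ℝ} (ht : t ∈ Icc (-T) T) {v : List ι} (hv : v.length ≤ k) :
    ‖wordCurve h hε hU₀ hU₀c Y v t‖ ^ 2 ≤ Real.exp (energyRate ι k M * T) * wordEnergy k U₀ := by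
  refine le_trans ?_ (wordEnergyCurve_le h hε hU₀ hU₀c hY0 hY hM ht)
  exact Finset.single_le_sum (f := fun v ↦ ‖wordCurve h hε hU₀ hU₀c Y v t‖ ^ 2) (fun _ _ ↦ sq_nonneg _)
    (mem_wordsLE.2 hv)

include hY0 hY in
/-- **The a-priori bound for the smooth representatives, uniform in `ε`**:
`ℰ_k(V_ε(t)) ≤ e^{K T} ℰ_k(U₀)` for `|t| ≤ T`. [cite: Friedrichs1954, §4] -/
theorem wordEnergy_smoothSol_le_exp {T : ℝ} {k : ℕ} {M : ℝ}
    (hM : ∀ t ∈ Icc (-T) T, IsSymmCoeff k M (fun j ↦ A j t) (B t)) {t : ℝ} (ht : t ∈ Icc (-T) T) :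
    wordEnergy k (smoothSol hε Y t) ≤ Real.exp (energyRate ι k M * T) * wordEnergy k U₀ :=
  (wordEnergy_smoothSol_le h hε hU₀ hU₀c hY0 hY k t).trans (wordEnergyCurve_le h hε hU₀ hU₀c hY0 hY hM ht)

include hY0 hY in
/-- **`L²` bounds for the word derivatives of the smooth representatives, uniform in `ε`**:
`‖∂_vV_ε(t)‖₂ ≤ (e^{K T} ℰ_k(U₀))^{1/2}` for `|v| ≤ k`, `|t| ≤ T`. [cite: Friedrichs1954, §4] -/
theorem l2norm_cwd_smoothSol_le {T : ℝ} {k : ℕ} {M : ℝ}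
    (hM : ∀ t ∈ Icc (-T) T, IsSymmCoeff k M (fun j ↦ A j t) (B t)) {t : ℝ} (ht : t ∈ Icc (-T) T)
    {v : List ι} (hv : v.length ≤ k) :
    l2norm (cwd v (smoothSol hε Y t)) ≤ Real.sqrt (Real.exp (energyRate ι k M * T) * wordEnergy k U₀) := by
  refine (l2norm_cwd_le_sqrt_wordEnergy hv _).trans (Real.sqrt_le_sqrt ?_)
  exact wordEnergy_smoothSol_le_exp h hε hU₀ hU₀c hY0 hY hM ht

end APriori

end Literature.Analysis.PDE

end

noncomputable section

open MeasureTheory Set Function Filter Metric ContinuousLinearMap intervalIntegral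
open scoped ContDiff Topology RealInnerProductSpace ENNReal NNReal Convolution

namespace Literature.Analysis.PDE

open Literature.Analysis.FunctionSpaces

variable {ι : Type*} [Fintype ι] [DecidableEq ι]
variable {W : Type*} [NormedAddCommGroup W] [InnerProductSpace ℝ W] [CompleteSpace W]
variable {A : ι → ℝ → EuclideanSpace ℝ ι → (W →L[ℝ] W)} {B : ℝ → EuclideanSpace ℝ ι → (W →L[ℝ] W)}

/-! ### Small tools: differences -/

section Tools

variable {A' : ι → EuclideanSpace ℝ ι → (W →L[ℝ] W)} {B' : EuclideanSpace ℝ ι → (W →L[ℝ] W)}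

omit [DecidableEq ι] [CompleteSpace W] in
/-- `𝒫` is linear in the field: `𝒫 (U − V) = 𝒫U − 𝒫V`. [folklore] -/
theorem foOp_fun_sub {U V : EuclideanSpace ℝ ι → W} (hU : Differentiable ℝ U) (hV : Differentiable ℝ V) :
    foOp A' B' (fun x ↦ U x - V x) = fun x ↦ foOp A' B' U x - foOp A' B' V x := by
  funext x
  have hsub : (fun x ↦ U x - V x) = U - V := rfl
  simp only [foOp_apply, hsub, fderiv_sub (hU x) (hV x), Pi.sub_apply, sub_apply,
    map_sub, Finset.sum_sub_distrib]
  abel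

omit [DecidableEq ι] [CompleteSpace W] in
/-- Differences of `H^k`-smooth fields are `H^k`-smooth. [folklore] -/
theorem IsHkSmooth.fun_sub {k : ℕ} {U V : EuclideanSpace ℝ ι → W} (hU : IsHkSmooth k U) (hV : IsHkSmooth k V) :
    IsHkSmooth k (fun x ↦ U x - V x) := by
  refine ⟨hU.smooth.sub hV.smooth, fun v hv ↦ ?_⟩
  rw [cwd_fun_sub hU.smooth hV.smooth]
  exact (hU.memLp v hv).sub (hV.memLp v hv)

variable {ρ : EuclideanSpace ℝ ι → ℝ}

omit [DecidableEq ι] [InnerProductSpace ℝ W] [CompleteSpace W] in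
/-- Convolution with a kernel distributes over differences of continuous fields. [folklore] -/
theorem convolution_kernel_fun_sub [NormedSpace ℝ W] (hρ : Continuous ρ) (hρc : HasCompactSupport ρ)
    {f g : EuclideanSpace ℝ ι → W} (hf : Continuous f) (hg : Continuous g) :
    ρ ⋆[lsmul ℝ ℝ, volume] (fun x ↦ f x - g x) =
      fun x ↦ (ρ ⋆[lsmul ℝ ℝ, volume] f) x - (ρ ⋆[lsmul ℝ ℝ, volume] g) x := by
  have hexf : ConvolutionExists ρ f (lsmul ℝ ℝ) volume :=
    hρc.convolutionExists_left _ hρ hf.locallyIntegrable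
  have hexg : ConvolutionExists ρ ((-1 : ℝ) • g) (lsmul ℝ ℝ) volume :=
    hρc.convolutionExists_left _ hρ (hg.const_smul _).locallyIntegrable
  have hfun : (fun x ↦ f x - g x) = f + (-1 : ℝ) • g := by
    funext x; simp [sub_eq_add_neg]
  rw [hfun, hexf.distrib_add hexg, convolution_smul]
  funext x
  simp [sub_eq_add_neg]

omit [DecidableEq ι] [InnerProductSpace ℝ W] [CompleteSpace W] in
/-- `‖f − g‖₂ ≤ ‖f‖₂ + ‖g‖₂` for `f, g ∈ L²`. [folklore] -/
theorem l2norm_sub_le {f g : EuclideanSpace ℝ ι → W} (hf : MemLp f 2 (volume : Measure (EuclideanSpace ℝ ι)))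
    (hg : MemLp g 2 (volume : Measure (EuclideanSpace ℝ ι))) :
    l2norm (fun x ↦ f x - g x) ≤ l2norm f + l2norm g := by
  have h1 : (fun x ↦ f x - g x) = fun x ↦ f x + (fun y ↦ -g y) x := by
    funext x; simp [sub_eq_add_neg]
  have hneg : l2norm (fun y ↦ -g y) = l2norm g := by
    rw [l2norm_def, l2norm_def, show (fun y ↦ -g y) = -g from rfl, eLpNorm_neg]
  rw [h1, ← hneg]
  exact l2norm_add_le hf hg.neg

end Tools

/-! ### The rate of double mollification in `L²` -/

section Rate

omit [DecidableEq ι] in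
/-- **`‖J_ε(J_ε g) − g‖₂ ≤ 2 ε Σⱼ ‖∂ⱼ g‖₂`** for a `C¹` field with square-integrable gradient
(`J²g − g = J(Jg − g) + (Jg − g)`, Young with unit mass and the rate of mollification).
[cite: Friedrichs1954, §4] -/
theorem memLp_moll_moll_sub_self_and_l2norm_le {ε : ℝ} (hε : 0 < ε) {g : EuclideanSpace ℝ ι → W}
    (hg : ContDiff ℝ 1 g) (hL2 : ∀ j, MemLp (fun y ↦ fderiv ℝ g y (bv j)) 2 (volume : Measure (EuclideanSpace ℝ ι))) :
    MemLp (fun x ↦ (moll ι hε ⋆[lsmul ℝ ℝ, volume] (moll ι hε ⋆[lsmul ℝ ℝ, volume] g)) x - g x) 2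
        (volume : Measure (EuclideanSpace ℝ ι)) ∧
      l2norm (fun x ↦ (moll ι hε ⋆[lsmul ℝ ℝ, volume] (moll ι hε ⋆[lsmul ℝ ℝ, volume] g)) x - g x) ≤
        2 * ε * ∑ j, l2norm (fun y ↦ fderiv ℝ g y (bv j)) := by
  set ρ := moll ι hε with hρdef
  have hρ : Continuous ρ := continuous_moll hε
  have hρc : HasCompactSupport ρ := hasCompactSupport_moll hε
  -- the first-order difference
  have h1 := l2norm_normed_convolution_sub_self_le (bump ι hε) hg hL2
  rw [bump_rOut] at h1
  change MemLp (fun x ↦ (ρ ⋆[lsmul ℝ ℝ, volume] g) x - g x) 2 volume ∧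
    l2norm (fun x ↦ (ρ ⋆[lsmul ℝ ℝ, volume] g) x - g x) ≤ ε * ∑ j, l2norm (fun y ↦ fderiv ℝ g y (bv j)) at h1
  set e : EuclideanSpace ℝ ι → W := fun x ↦ (ρ ⋆[lsmul ℝ ℝ, volume] g) x - g x with he
  -- `J e`
  have h2 := memLp_normed_convolution_and_l2norm_le (bump ι hε) h1.1
  change MemLp (ρ ⋆[lsmul ℝ ℝ, volume] e) 2 volume ∧ l2norm (ρ ⋆[lsmul ℝ ℝ, volume] e) ≤ l2norm e at h2
  -- `J²g − g = J e + e`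
  have hJg : Continuous (ρ ⋆[lsmul ℝ ℝ, volume] g) :=
    (hρc.continuous_convolution_left _ hρ hg.continuous.locallyIntegrable)
  have hsplit : (fun x ↦ (ρ ⋆[lsmul ℝ ℝ, volume] (ρ ⋆[lsmul ℝ ℝ, volume] g)) x - g x) =
      fun x ↦ (ρ ⋆[lsmul ℝ ℝ, volume] e) x + e x := by
    have hce := convolution_kernel_fun_sub hρ hρc hJg hg.continuous
    funext x
    rw [show (ρ ⋆[lsmul ℝ ℝ, volume] e) x = (ρ ⋆[lsmul ℝ ℝ, volume] (ρ ⋆[lsmul ℝ ℝ, volume] g)) x -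
      (ρ ⋆[lsmul ℝ ℝ, volume] g) x from congrFun hce x]
    simp only [he]
    abel
  rw [hsplit]
  refine ⟨h2.1.add h1.1, (l2norm_add_le h2.1 h1.1).trans ?_⟩
  linarith [h2.2, h1.2]

end Rate

/-! ### The difference of two regularised solutions -/

section Diff

variable (h : IsRegularSymmCoeffFamily A B) {ε δ : ℝ} (hε : 0 < ε) (hδ : 0 < δ)
variable {U₀ : EuclideanSpace ℝ ι → W} (hU₀ : ContDiff ℝ ∞ U₀) (hU₀c : HasCompactSupport U₀)
variable {Y Y' : ℝ → Lp W 2 (volume : Measure (EuclideanSpace ℝ ι))}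
  (hY0 : Y 0 = (hU₀.continuous.memLp_of_hasCompactSupport hU₀c).toLp U₀)
  (hY : ∀ t, HasDerivAt Y (regField h hε t (Y t)) t)
  (hY0' : Y' 0 = (hU₀.continuous.memLp_of_hasCompactSupport hU₀c).toLp U₀)
  (hY' : ∀ t, HasDerivAt Y' (regField h hδ t (Y' t)) t)

/-- **The difference of the smooth representatives** `D = V^ε − V^δ`. [cite: Friedrichs1954, §4] -/
def diffSol (Y Y' : ℝ → Lp W 2 (volume : Measure (EuclideanSpace ℝ ι))) (t : ℝ) : EuclideanSpace ℝ ι → W :=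
  fun x ↦ smoothSol hε Y t x - smoothSol hδ Y' t x

omit [DecidableEq ι] [CompleteSpace W] in
/-- The difference is `H^k`-smooth of every order. [cite: Friedrichs1954, §4] -/
theorem isHkSmooth_diffSol (t : ℝ) (k : ℕ) : IsHkSmooth k (diffSol hε hδ Y Y' t) :=
  (isHkSmooth_smoothSol hε Y t k).fun_sub (isHkSmooth_smoothSol hδ Y' t k)

omit [DecidableEq ι] [CompleteSpace W] in
/-- Word derivatives of the difference. [folklore] -/
theorem cwd_diffSol (t : ℝ) (v : List ι) :
    cwd v (diffSol hε hδ Y Y' t) = fun x ↦ cwd v (smoothSol hε Y t) x - cwd v (smoothSol hδ Y' t) x :=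
  cwd_fun_sub (contDiff_smoothSol hε Y t) (contDiff_smoothSol hδ Y' t) v

/-- **The difference curves** `J_ε wordCurve^ε v − J_δ wordCurve^δ v ∈ L²`, represented by `∂_v D`.
[cite: Friedrichs1954, §4] -/
def diffCurve (Y Y' : ℝ → Lp W 2 (volume : Measure (EuclideanSpace ℝ ι))) (v : List ι) (t : ℝ) :
    Lp W 2 (volume : Measure (EuclideanSpace ℝ ι)) :=
  mollL2 hε (wordCurve h hε hU₀ hU₀c Y v t) - mollL2 hδ (wordCurve h hδ hU₀ hU₀c Y' v t)

include hY0 hY hY0' hY' in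
omit [DecidableEq ι] in
/-- The difference curve is represented by `∂_v D(t)` almost everywhere. [cite: Friedrichs1954, §4] -/
theorem coeFn_diffCurve (v : List ι) (t : ℝ) :
    (diffCurve h hε hδ hU₀ hU₀c Y Y' v t : EuclideanSpace ℝ ι → W) =ᵐ[(volume : Measure (EuclideanSpace ℝ ι))]
      cwd v (diffSol hε hδ Y Y' t) := by
  have h1 := coeFn_convL2 (continuous_moll hε) (hasCompactSupport_moll hε) (wordCurve h hε hU₀ hU₀c Y v t) (W := W)
  have h2 := coeFn_convL2 (continuous_moll hδ) (hasCompactSupport_moll hδ) (wordCurve h hδ hU₀ hU₀c Y' v t) (W := W)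
  rw [cwd_diffSol]
  unfold diffCurve mollL2
  filter_upwards [Lp.coeFn_sub (convL2 (moll ι hε) (continuous_moll hε) (hasCompactSupport_moll hε)
      (wordCurve h hε hU₀ hU₀c Y v t)) (convL2 (moll ι hδ) (continuous_moll hδ) (hasCompactSupport_moll hδ)
      (wordCurve h hδ hU₀ hU₀c Y' v t)), h1, h2] with x hx hx1 hx2
  rw [hx, Pi.sub_apply, hx1, hx2, cwd_smoothSol_eq h hε hU₀ hU₀c hY0 hY v t,
    cwd_smoothSol_eq h hδ hU₀ hU₀c hY0' hY' v t, smoothRep, smoothRep]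

include hY0 hY hY0' hY' in
omit [DecidableEq ι] in
/-- `‖diffCurve v t‖ = ‖∂_v D(t)‖₂`. [cite: Friedrichs1954, §4] -/
theorem norm_diffCurve (v : List ι) (t : ℝ) :
    ‖diffCurve h hε hδ hU₀ hU₀c Y Y' v t‖ = l2norm (cwd v (diffSol hε hδ Y Y' t)) := by
  rw [Lp.norm_def, l2norm_def, eLpNorm_congr_ae (coeFn_diffCurve h hε hδ hU₀ hU₀c hY0 hY hY0' hY' v t)]

include hY hY' in
omit [DecidableEq ι] in
/-- **The difference curves are `C¹`** with derivative `J_ε wordForcing^ε v − J_δ wordForcing^δ v`.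
[cite: Friedrichs1954, §4] -/
theorem hasDerivAt_diffCurve (v : List ι) (t : ℝ) :
    HasDerivAt (diffCurve h hε hδ hU₀ hU₀c Y Y' v)
      (mollL2 hε (wordForcing h hε Y v t) - mollL2 hδ (wordForcing h hδ Y' v t)) t :=
  ((mollL2 hε).hasFDerivAt.comp_hasDerivAt t
    (hasDerivAt_wordCurve h hε hU₀ hU₀c (continuous_of_regSolution h hε hY) v t)).sub
    ((mollL2 hδ).hasFDerivAt.comp_hasDerivAt t
      (hasDerivAt_wordCurve h hδ hU₀ hU₀c (continuous_of_regSolution h hδ hY') v t))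

/-- Shorthand: the double mollification `J_ε J_ε g`. [cite: Friedrichs1954, §4] -/
def moll2 {ε : ℝ} (hε : 0 < ε) (g : EuclideanSpace ℝ ι → W) : EuclideanSpace ℝ ι → W :=
  moll ι hε ⋆[lsmul ℝ ℝ, volume] (moll ι hε ⋆[lsmul ℝ ℝ, volume] g)

omit [DecidableEq ι] [CompleteSpace W] in
/-- The derivative of the difference curve is represented by `J_ε²∂_v𝒫V^ε − J_δ²∂_v𝒫V^δ` almost
everywhere. [cite: Friedrichs1954, §4] -/
theorem coeFn_deriv_diffCurve (v : List ι) (t : ℝ) :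
    ((mollL2 hε (wordForcing h hε Y v t) - mollL2 hδ (wordForcing h hδ Y' v t) :
        Lp W 2 (volume : Measure (EuclideanSpace ℝ ι))) : EuclideanSpace ℝ ι → W)
      =ᵐ[(volume : Measure (EuclideanSpace ℝ ι))]
      fun x ↦ moll2 hε (cwd v (foOp (fun j ↦ A j t) (B t) (smoothSol hε Y t))) x -
        moll2 hδ (cwd v (foOp (fun j ↦ A j t) (B t) (smoothSol hδ Y' t))) x := by
  have h1 := coeFn_convL2 (continuous_moll hε) (hasCompactSupport_moll hε) (wordForcing h hε Y v t) (W := W)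
  have h2 := coeFn_convL2 (continuous_moll hδ) (hasCompactSupport_moll hδ) (wordForcing h hδ Y' v t) (W := W)
  unfold mollL2
  filter_upwards [Lp.coeFn_sub (convL2 (moll ι hε) (continuous_moll hε) (hasCompactSupport_moll hε)
      (wordForcing h hε Y v t)) (convL2 (moll ι hδ) (continuous_moll hδ) (hasCompactSupport_moll hδ)
      (wordForcing h hδ Y' v t)), h1, h2] with x hx hx1 hx2
  rw [hx, Pi.sub_apply, hx1, hx2, convolution_kernel_congr_ae (coeFn_wordForcing h hε Y v t),
    convolution_kernel_congr_ae (coeFn_wordForcing h hδ Y' v t)]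
  rfl

/-! ### The remainder field and its bound -/

omit [DecidableEq ι] [CompleteSpace W] in
/-- Word derivatives commute with the double mollification of a smooth field. [cite: Friedrichs1954, §4] -/
theorem cwd_moll2 {ε : ℝ} (hε : 0 < ε) {g : EuclideanSpace ℝ ι → W} (hg : ContDiff ℝ ∞ g) (v : List ι) :
    cwd v (moll2 hε g) = moll2 hε (cwd v g) := by
  have hρ := continuous_moll (ι := ι) hε
  have hρc := hasCompactSupport_moll (ι := ι) hε
  have hJg : ContDiff ℝ ∞ (moll ι hε ⋆[lsmul ℝ ℝ, volume] g) :=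
    contDiff_convolution_kernel (contDiff_moll hε) hρc hg.continuous.locallyIntegrable
  rw [moll2, cwd_convolution_eq_convolution_cwd hρ hρc hJg, cwd_convolution_eq_convolution_cwd hρ hρc hg, moll2]

omit [DecidableEq ι] [CompleteSpace W] in
/-- The double mollification of a smooth field is smooth. [folklore] -/
theorem contDiff_moll2 {ε : ℝ} (hε : 0 < ε) {g : EuclideanSpace ℝ ι → W} (hg : ContDiff ℝ ∞ g) :
    ContDiff ℝ ∞ (moll2 hε g) := by
  have hρc := hasCompactSupport_moll (ι := ι) hε
  have hJg : ContDiff ℝ ∞ (moll ι hε ⋆[lsmul ℝ ℝ, volume] g) :=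
    contDiff_convolution_kernel (contDiff_moll hε) hρc hg.continuous.locallyIntegrable
  exact contDiff_convolution_kernel (contDiff_moll hε) hρc hJg.continuous.locallyIntegrable

omit [CompleteSpace W] in
/-- **Square integrability and the `L²` bound of the word derivatives of `𝒫(t) V(t)`** through the
word energy one order up: `‖∂_v 𝒫V‖₂ ≤ (n+1) 2^{k} M √ℰ_{k+1}(V)` for `|v| ≤ k` and coefficients
admissible of order `k` with bound `M`. [cite: Friedrichs1954, §4] -/
theorem memLp_cwd_foOp_smoothSol {ε : ℝ} (hε : 0 < ε) (Y : ℝ → Lp W 2 (volume : Measure (EuclideanSpace ℝ ι)))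
    {t : ℝ} {k : ℕ} {M : ℝ} (hc : IsSymmCoeff k M (fun j ↦ A j t) (B t)) {v : List ι} (hv : v.length ≤ k) :
    MemLp (cwd v (foOp (fun j ↦ A j t) (B t) (smoothSol hε Y t))) 2 (volume : Measure (EuclideanSpace ℝ ι)) ∧
      l2norm (cwd v (foOp (fun j ↦ A j t) (B t) (smoothSol hε Y t))) ≤
        (Fintype.card ι + 1) * 2 ^ k * M * Real.sqrt (wordEnergy (k + 1) (smoothSol hε Y t)) :=
  memLp_cwd_foOp_and_l2norm_le hc (isHkSmooth_smoothSol hε Y t (k + 1)) hv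

include h in
/-- **The remainder bound**: for `|v| ≤ k` and coefficients admissible of order `k + 1` with bound
`M`, `‖J_ε²∂_v𝒫V − ∂_v𝒫V‖₂ ≤ 2ε · n (n+1) 2^{k+1} M √ℰ_{k+2}(V)`. [cite: Friedrichs1954, §4] -/
theorem l2norm_moll2_cwd_foOp_sub_le {ε : ℝ} (hε : 0 < ε) (Y : ℝ → Lp W 2 (volume : Measure (EuclideanSpace ℝ ι)))
    {t : ℝ} {k : ℕ} {M : ℝ} (hc : IsSymmCoeff (k + 1) M (fun j ↦ A j t) (B t)) {v : List ι} (hv : v.length ≤ k) :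
    MemLp (fun x ↦ moll2 hε (cwd v (foOp (fun j ↦ A j t) (B t) (smoothSol hε Y t))) x -
        cwd v (foOp (fun j ↦ A j t) (B t) (smoothSol hε Y t)) x) 2 (volume : Measure (EuclideanSpace ℝ ι)) ∧
      l2norm (fun x ↦ moll2 hε (cwd v (foOp (fun j ↦ A j t) (B t) (smoothSol hε Y t))) x -
        cwd v (foOp (fun j ↦ A j t) (B t) (smoothSol hε Y t)) x) ≤
        2 * ε * (Fintype.card ι * ((Fintype.card ι + 1) * 2 ^ (k + 1) * M *
          Real.sqrt (wordEnergy (k + 2) (smoothSol hε Y t)))) := by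
  set P := foOp (fun j ↦ A j t) (B t) (smoothSol hε Y t) with hP
  have hPs : ContDiff ℝ ∞ P := contDiff_foOp_smoothSol h hε Y t
  have hg : ContDiff ℝ 1 (cwd v P) := (contDiff_cwd hPs v).of_le (by norm_num)
  have hder : ∀ j, (fun y ↦ fderiv ℝ (cwd v P) y (bv j)) = cwd (j :: v) P := fun j ↦ rfl
  have hL2 : ∀ j, MemLp (fun y ↦ fderiv ℝ (cwd v P) y (bv j)) 2 (volume : Measure (EuclideanSpace ℝ ι)) ∧
      l2norm (fun y ↦ fderiv ℝ (cwd v P) y (bv j)) ≤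
        (Fintype.card ι + 1) * 2 ^ (k + 1) * M * Real.sqrt (wordEnergy (k + 2) (smoothSol hε Y t)) := by
    intro j
    rw [hder j]
    exact memLp_cwd_foOp_smoothSol hε Y hc (v := j :: v) (by simp; omega)
  have hmain := memLp_moll_moll_sub_self_and_l2norm_le hε hg (fun j ↦ (hL2 j).1)
  refine ⟨hmain.1, hmain.2.trans ?_⟩
  have hε2 : 0 ≤ 2 * ε := by linarith
  refine mul_le_mul_of_nonneg_left ?_ hε2
  calc ∑ j, l2norm (fun y ↦ fderiv ℝ (cwd v P) y (bv j))
      ≤ ∑ _j : ι, (Fintype.card ι + 1) * 2 ^ (k + 1) * M * Real.sqrt (wordEnergy (k + 2) (smoothSol hε Y t)) :=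
        Finset.sum_le_sum fun j _ ↦ (hL2 j).2
    _ = _ := by rw [Finset.sum_const, Finset.card_univ, nsmul_eq_mul]

/-! ### The energy of the difference and its differential inequality -/

/-- **The energy of order `k` of the difference**: `d_k(t) = Σ_{|v| ≤ k} ‖diffCurve v t‖²`.
[cite: Friedrichs1954, §4] -/
def diffEnergy (Y Y' : ℝ → Lp W 2 (volume : Measure (EuclideanSpace ℝ ι))) (k : ℕ) (t : ℝ) : ℝ :=
  ∑ v ∈ wordsLE ι k, ‖diffCurve h hε hδ hU₀ hU₀c Y Y' v t‖ ^ 2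

omit [CompleteSpace W] in
/-- `0 ≤ d_k(t)`. [folklore] -/
theorem diffEnergy_nonneg (k : ℕ) (t : ℝ) : 0 ≤ diffEnergy h hε hδ hU₀ hU₀c Y Y' k t :=
  Finset.sum_nonneg fun _ _ ↦ sq_nonneg _

include hY0 hY hY0' hY' in
/-- `d_k(t) = ℰ_k(D(t))`. [cite: Friedrichs1954, §4] -/
theorem diffEnergy_eq_wordEnergy (k : ℕ) (t : ℝ) :
    diffEnergy h hε hδ hU₀ hU₀c Y Y' k t = wordEnergy k (diffSol hε hδ Y Y' t) := by
  unfold diffEnergy wordEnergy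
  exact Finset.sum_congr rfl fun v _ ↦ by rw [norm_diffCurve h hε hδ hU₀ hU₀c hY0 hY hY0' hY']

include hY hY' in
/-- **`d_k` is differentiable** with `d_k' = Σ_v 2⟪diffCurve v, J_εwordForcing^ε v − J_δwordForcing^δ v⟫`.
[cite: Friedrichs1954, §4] -/
theorem hasDerivAt_diffEnergy (k : ℕ) (t : ℝ) :
    HasDerivAt (diffEnergy h hε hδ hU₀ hU₀c Y Y' k)
      (∑ v ∈ wordsLE ι k, 2 * ⟪diffCurve h hε hδ hU₀ hU₀c Y Y' v t,
        mollL2 hε (wordForcing h hε Y v t) - mollL2 hδ (wordForcing h hδ Y' v t)⟫) t := by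
  have hv : ∀ v ∈ wordsLE ι k, HasDerivAt (fun s ↦ ‖diffCurve h hε hδ hU₀ hU₀c Y Y' v s‖ ^ 2)
      (2 * ⟪diffCurve h hε hδ hU₀ hU₀c Y Y' v t,
        mollL2 hε (wordForcing h hε Y v t) - mollL2 hδ (wordForcing h hδ Y' v t)⟫) t := fun v _ ↦
    (hasDerivAt_diffCurve h hε hδ hU₀ hU₀c hY hY' v t).norm_sq
  exact HasDerivAt.fun_sum (u := wordsLE ι k) hv

include hY0 hY hY0' hY' in
/-- **The inner products in the derivative of `d_k`**:
`⟪diffCurve v, (diffCurve v)'⟫ = ∫⟪∂_vD, ∂_v(𝒫D)⟫ + ∫⟪∂_vD, ∂_vR⟫` with the remainder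
`R = (J_ε²𝒫V^ε − 𝒫V^ε) − (J_δ²𝒫V^δ − 𝒫V^δ)`. [cite: Friedrichs1954, §4] -/
theorem inner_diffCurve_deriv (v : List ι) (t : ℝ) {k : ℕ} {M : ℝ} (hc : IsSymmCoeff (k + 1) M (fun j ↦ A j t) (B t))
    (hv : v.length ≤ k) :
    ⟪diffCurve h hε hδ hU₀ hU₀c Y Y' v t, mollL2 hε (wordForcing h hε Y v t) - mollL2 hδ (wordForcing h hδ Y' v t)⟫ =
      (∫ x, ⟪cwd v (diffSol hε hδ Y Y' t) x,
        cwd v (foOp (fun j ↦ A j t) (B t) (diffSol hε hδ Y Y' t)) x⟫) +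
      ∫ x, ⟪cwd v (diffSol hε hδ Y Y' t) x,
        cwd v (fun y ↦ (moll2 hε (foOp (fun j ↦ A j t) (B t) (smoothSol hε Y t)) y -
            foOp (fun j ↦ A j t) (B t) (smoothSol hε Y t) y) -
          (moll2 hδ (foOp (fun j ↦ A j t) (B t) (smoothSol hδ Y' t)) y -
            foOp (fun j ↦ A j t) (B t) (smoothSol hδ Y' t) y)) x⟫ := by
  set P := foOp (fun j ↦ A j t) (B t) (smoothSol hε Y t) with hP
  set P' := foOp (fun j ↦ A j t) (B t) (smoothSol hδ Y' t) with hP'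
  have hPs : ContDiff ℝ ∞ P := contDiff_foOp_smoothSol h hε Y t
  have hP's : ContDiff ℝ ∞ P' := contDiff_foOp_smoothSol h hδ Y' t
  have hD := isHkSmooth_diffSol hε hδ (Y := Y) (Y' := Y') t (k + 1)
  -- the pointwise decomposition of the integrand
  have hdecomp : ∀ x, moll2 hε (cwd v P) x - moll2 hδ (cwd v P') x =
      cwd v (foOp (fun j ↦ A j t) (B t) (diffSol hε hδ Y Y' t)) x +
        cwd v (fun y ↦ (moll2 hε P y - P y) - (moll2 hδ P' y - P' y)) x := by
    intro x
    have hsub1 : ContDiff ℝ ∞ fun y ↦ moll2 hε P y - P y := (contDiff_moll2 hε hPs).sub hPs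
    have hsub2 : ContDiff ℝ ∞ fun y ↦ moll2 hδ P' y - P' y := (contDiff_moll2 hδ hP's).sub hP's
    unfold diffSol
    rw [foOp_fun_sub ((contDiff_smoothSol hε Y t).differentiable (by simp))
      ((contDiff_smoothSol hδ Y' t).differentiable (by simp)), ← hP, ← hP',
      cwd_fun_sub hPs hP's, cwd_fun_sub hsub1 hsub2, cwd_fun_sub (contDiff_moll2 hε hPs) hPs,
      cwd_fun_sub (contDiff_moll2 hδ hP's) hP's, cwd_moll2 hε hPs, cwd_moll2 hδ hP's]
    simp only
    abel
  -- integrability of the two pieces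
  have hDv : MemLp (cwd v (diffSol hε hδ Y Y' t)) 2 (volume : Measure (EuclideanSpace ℝ ι)) :=
    hD.memLp v (by omega)
  have hPD : MemLp (cwd v (foOp (fun j ↦ A j t) (B t) (diffSol hε hδ Y Y' t))) 2
      (volume : Measure (EuclideanSpace ℝ ι)) :=
    (memLp_cwd_foOp_and_l2norm_le (hc.mono (Nat.le_succ k)) hD hv).1
  have hR1 := l2norm_moll2_cwd_foOp_sub_le h hε Y hc (v := v) hv
  have hR2 := l2norm_moll2_cwd_foOp_sub_le h hδ Y' hc (v := v) hv
  have hRv : MemLp (cwd v (fun y ↦ (moll2 hε P y - P y) - (moll2 hδ P' y - P' y))) 2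
      (volume : Measure (EuclideanSpace ℝ ι)) := by
    have hsub1 : ContDiff ℝ ∞ fun y ↦ moll2 hε P y - P y := (contDiff_moll2 hε hPs).sub hPs
    have hsub2 : ContDiff ℝ ∞ fun y ↦ moll2 hδ P' y - P' y := (contDiff_moll2 hδ hP's).sub hP's
    rw [cwd_fun_sub hsub1 hsub2, cwd_fun_sub (contDiff_moll2 hε hPs) hPs,
      cwd_fun_sub (contDiff_moll2 hδ hP's) hP's, cwd_moll2 hε hPs, cwd_moll2 hδ hP's]
    exact hR1.1.sub hR2.1
  -- compute
  rw [L2.inner_def, ← integral_add (integrable_inner_of_memLp hDv hPD) (integrable_inner_of_memLp hDv hRv)]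
  refine integral_congr_ae ?_
  filter_upwards [coeFn_diffCurve h hε hδ hU₀ hU₀c hY0 hY hY0' hY' v t,
    coeFn_deriv_diffCurve h hε hδ (Y := Y) (Y' := Y') v t] with x hx1 hx2
  rw [hx1, hx2, ← inner_add_right, ← hdecomp x]

include hY0 hY hY0' hY' in
/-- **The differential inequality for the energy of the difference**:
`|d_k'| ≤ K d_k + 2 N_k b √d_k`, `K = energyRate k M₀` (`M₀` a coefficient bound of order `k`),
`b = 2(ε + δ) n (n+1) 2^{k+1} M₁ √S` with `M₁` a coefficient bound of order `k + 1` and `S` a bound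
for `ℰ_{k+2}` of both smooth representatives at time `t`. [cite: Friedrichs1954, §4] -/
theorem abs_deriv_diffEnergy_le {k : ℕ} {M₀ M₁ S : ℝ} {t : ℝ}
    (hc₀ : IsSymmCoeff k M₀ (fun j ↦ A j t) (B t)) (hc₁ : IsSymmCoeff (k + 1) M₁ (fun j ↦ A j t) (B t))
    (hS : wordEnergy (k + 2) (smoothSol hε Y t) ≤ S) (hS' : wordEnergy (k + 2) (smoothSol hδ Y' t) ≤ S) :
    |∑ v ∈ wordsLE ι k, 2 * ⟪diffCurve h hε hδ hU₀ hU₀c Y Y' v t,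
        mollL2 hε (wordForcing h hε Y v t) - mollL2 hδ (wordForcing h hδ Y' v t)⟫| ≤
      energyRate ι k M₀ * diffEnergy h hε hδ hU₀ hU₀c Y Y' k t +
        2 * ((wordsLE ι k).card * (2 * (ε + δ) * (Fintype.card ι * ((Fintype.card ι + 1) * 2 ^ (k + 1) * M₁ *
          Real.sqrt S))) * Real.sqrt (diffEnergy h hε hδ hU₀ hU₀c Y Y' k t)) := by
  set D := diffSol hε hδ Y Y' t with hDdef
  set P := foOp (fun j ↦ A j t) (B t) (smoothSol hε Y t) with hP
  set P' := foOp (fun j ↦ A j t) (B t) (smoothSol hδ Y' t) with hP'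
  set R : EuclideanSpace ℝ ι → W := fun y ↦ (moll2 hε P y - P y) - (moll2 hδ P' y - P' y) with hR
  have hD : IsHkSmooth (k + 1) D := isHkSmooth_diffSol hε hδ t (k + 1)
  have hPs : ContDiff ℝ ∞ P := contDiff_foOp_smoothSol h hε Y t
  have hP's : ContDiff ℝ ∞ P' := contDiff_foOp_smoothSol h hδ Y' t
  -- rewrite the sum
  have hsum : ∑ v ∈ wordsLE ι k, 2 * ⟪diffCurve h hε hδ hU₀ hU₀c Y Y' v t,
      mollL2 hε (wordForcing h hε Y v t) - mollL2 hδ (wordForcing h hδ Y' v t)⟫ =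
      (2 * ∑ v ∈ wordsLE ι k, ∫ x, ⟪cwd v D x, cwd v (foOp (fun j ↦ A j t) (B t) D) x⟫) +
        2 * ∑ v ∈ wordsLE ι k, ∫ x, ⟪cwd v D x, cwd v R x⟫ := by
    rw [Finset.mul_sum, Finset.mul_sum, ← Finset.sum_add_distrib]
    refine Finset.sum_congr rfl fun v hv ↦ ?_
    rw [inner_diffCurve_deriv h hε hδ hU₀ hU₀c hY0 hY hY0' hY' v t hc₁ (mem_wordsLE.1 hv), mul_add]
  rw [hsum]
  -- the first term: energy inequality
  have h1 : |2 * ∑ v ∈ wordsLE ι k, ∫ x, ⟪cwd v D x, cwd v (foOp (fun j ↦ A j t) (B t) D) x⟫| ≤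
      energyRate ι k M₀ * diffEnergy h hε hδ hU₀ hU₀c Y Y' k t := by
    rw [abs_mul, abs_two, energyRate, mul_assoc, diffEnergy_eq_wordEnergy h hε hδ hU₀ hU₀c hY0 hY hY0' hY']
    exact mul_le_mul_of_nonneg_left (abs_sum_integral_inner_cwd_foOp_le hc₀ hD) zero_le_two
  -- the second term: the remainder bound
  set b := 2 * (ε + δ) * (Fintype.card ι * ((Fintype.card ι + 1) * 2 ^ (k + 1) * M₁ * Real.sqrt S)) with hb
  have hM₁ : 0 ≤ M₁ := hc₁.nonneg
  have hRb : ∀ v : List ι, v.length ≤ k → MemLp (cwd v R) 2 (volume : Measure (EuclideanSpace ℝ ι)) ∧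
      l2norm (cwd v R) ≤ b := by
    intro v hv
    have hsub1 : ContDiff ℝ ∞ fun y ↦ moll2 hε P y - P y := (contDiff_moll2 hε hPs).sub hPs
    have hsub2 : ContDiff ℝ ∞ fun y ↦ moll2 hδ P' y - P' y := (contDiff_moll2 hδ hP's).sub hP's
    have hR1 := l2norm_moll2_cwd_foOp_sub_le h hε Y hc₁ (v := v) hv
    have hR2 := l2norm_moll2_cwd_foOp_sub_le h hδ Y' hc₁ (v := v) hv
    rw [hR, cwd_fun_sub hsub1 hsub2, cwd_fun_sub (contDiff_moll2 hε hPs) hPs,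
      cwd_fun_sub (contDiff_moll2 hδ hP's) hP's, cwd_moll2 hε hPs, cwd_moll2 hδ hP's]
    refine ⟨hR1.1.sub hR2.1, (l2norm_sub_le hR1.1 hR2.1).trans ?_⟩
    have hsq : Real.sqrt (wordEnergy (k + 2) (smoothSol hε Y t)) ≤ Real.sqrt S := Real.sqrt_le_sqrt hS
    have hsq' : Real.sqrt (wordEnergy (k + 2) (smoothSol hδ Y' t)) ≤ Real.sqrt S := Real.sqrt_le_sqrt hS'
    have hc' : 0 ≤ (Fintype.card ι : ℝ) * ((Fintype.card ι + 1) * 2 ^ (k + 1) * M₁) := by positivity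
    calc l2norm (fun x ↦ moll2 hε (cwd v P) x - cwd v P x) + l2norm (fun x ↦ moll2 hδ (cwd v P') x - cwd v P' x)
        ≤ 2 * ε * (Fintype.card ι * ((Fintype.card ι + 1) * 2 ^ (k + 1) * M₁ *
            Real.sqrt (wordEnergy (k + 2) (smoothSol hε Y t)))) +
          2 * δ * (Fintype.card ι * ((Fintype.card ι + 1) * 2 ^ (k + 1) * M₁ *
            Real.sqrt (wordEnergy (k + 2) (smoothSol hδ Y' t)))) := add_le_add hR1.2 hR2.2
      _ ≤ 2 * ε * (Fintype.card ι * ((Fintype.card ι + 1) * 2 ^ (k + 1) * M₁ * Real.sqrt S)) +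
          2 * δ * (Fintype.card ι * ((Fintype.card ι + 1) * 2 ^ (k + 1) * M₁ * Real.sqrt S)) := by
          gcongr
      _ = b := by rw [hb]; ring
  have h2 : |2 * ∑ v ∈ wordsLE ι k, ∫ x, ⟪cwd v D x, cwd v R x⟫| ≤
      2 * ((wordsLE ι k).card * b * Real.sqrt (diffEnergy h hε hδ hU₀ hU₀c Y Y' k t)) := by
    rw [abs_mul, abs_two, diffEnergy_eq_wordEnergy h hε hδ hU₀ hU₀c hY0 hY hY0' hY']
    refine mul_le_mul_of_nonneg_left ?_ zero_le_two
    exact abs_sum_integral_inner_cwd_le (hD.mono (Nat.le_succ k)) (fun v hv ↦ (hRb v hv).1) fun v hv ↦ (hRb v hv).2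
  calc |(2 * ∑ v ∈ wordsLE ι k, ∫ x, ⟪cwd v D x, cwd v (foOp (fun j ↦ A j t) (B t) D) x⟫) +
        2 * ∑ v ∈ wordsLE ι k, ∫ x, ⟪cwd v D x, cwd v R x⟫|
      ≤ |2 * ∑ v ∈ wordsLE ι k, ∫ x, ⟪cwd v D x, cwd v (foOp (fun j ↦ A j t) (B t) D) x⟫| +
        |2 * ∑ v ∈ wordsLE ι k, ∫ x, ⟪cwd v D x, cwd v R x⟫| := abs_add_le _ _
    _ ≤ _ := add_le_add h1 h2

/-! ### The initial difference -/

omit [CompleteSpace W] in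
/-- The gradient sum `G_v(U₀) = Σⱼ ‖∂ⱼ∂_v U₀‖₂` of the data. [folklore] -/
def dataGradSum (U₀ : EuclideanSpace ℝ ι → W) (v : List ι) : ℝ := ∑ j, l2norm (cwd (j :: v) U₀)

omit [CompleteSpace W] [DecidableEq ι] in
/-- `0 ≤ G_v(U₀)`. [folklore] -/
theorem dataGradSum_nonneg (U₀ : EuclideanSpace ℝ ι → W) (v : List ι) : 0 ≤ dataGradSum U₀ v :=
  Finset.sum_nonneg fun _ _ ↦ l2norm_nonneg _

omit [DecidableEq ι] in
/-- **The rate of mollification of the data in `L²`**: `‖J_ε [∂_vU₀] − [∂_vU₀]‖ ≤ ε G_v(U₀)`.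
[cite: Friedrichs1954, §4] -/
theorem norm_mollL2_data_sub_le (v : List ι) :
    ‖mollL2 hε ((memLp_cwd_data hU₀ hU₀c v).toLp (cwd v U₀)) - (memLp_cwd_data hU₀ hU₀c v).toLp (cwd v U₀)‖ ≤
      ε * dataGradSum U₀ v := by
  have hg : ContDiff ℝ 1 (cwd v U₀) := (contDiff_cwd hU₀ v).of_le (by norm_num)
  have hL2 : ∀ j, MemLp (fun y ↦ fderiv ℝ (cwd v U₀) y (bv j)) 2 (volume : Measure (EuclideanSpace ℝ ι)) :=
    fun j ↦ memLp_cwd_data hU₀ hU₀c (j :: v)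
  have hrate := l2norm_normed_convolution_sub_self_le (bump ι hε) hg hL2
  rw [bump_rOut] at hrate
  rw [Lp.norm_def, ← l2norm_def]
  have hae : ((mollL2 hε ((memLp_cwd_data hU₀ hU₀c v).toLp (cwd v U₀)) -
      (memLp_cwd_data hU₀ hU₀c v).toLp (cwd v U₀) : Lp W 2 (volume : Measure (EuclideanSpace ℝ ι))) :
        EuclideanSpace ℝ ι → W) =ᵐ[(volume : Measure (EuclideanSpace ℝ ι))]
      fun x ↦ ((bump ι hε).normed volume ⋆[lsmul ℝ ℝ, volume] cwd v U₀) x - cwd v U₀ x := by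
    have h1 := coeFn_convL2 (continuous_moll hε) (hasCompactSupport_moll hε)
      ((memLp_cwd_data hU₀ hU₀c v).toLp (cwd v U₀)) (W := W)
    have h2 := MemLp.coeFn_toLp (memLp_cwd_data hU₀ hU₀c v)
    filter_upwards [Lp.coeFn_sub (mollL2 hε ((memLp_cwd_data hU₀ hU₀c v).toLp (cwd v U₀)))
      ((memLp_cwd_data hU₀ hU₀c v).toLp (cwd v U₀)), h1, h2] with x hx hx1 hx2
    rw [hx, Pi.sub_apply, mollL2, hx1, hx2, convolution_kernel_congr_ae (MemLp.coeFn_toLp _)]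
    rfl
  rw [l2norm_def, eLpNorm_congr_ae hae, ← l2norm_def]
  exact hrate.2

omit [DecidableEq ι] in
/-- **The initial difference**: `‖diffCurve v 0‖ ≤ (ε + δ) G_v(U₀)`. [cite: Friedrichs1954, §4] -/
theorem norm_diffCurve_zero_le (v : List ι) :
    ‖diffCurve h hε hδ hU₀ hU₀c Y Y' v 0‖ ≤ (ε + δ) * dataGradSum U₀ v := by
  set f := (memLp_cwd_data hU₀ hU₀c v).toLp (cwd v U₀) (μ := (volume : Measure (EuclideanSpace ℝ ι))) with hf
  have h1 := norm_mollL2_data_sub_le hε hU₀ hU₀c v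
  have h2 := norm_mollL2_data_sub_le hδ hU₀ hU₀c v
  rw [diffCurve, wordCurve_zero, wordCurve_zero]
  calc ‖mollL2 hε f - mollL2 hδ f‖ = ‖(mollL2 hε f - f) - (mollL2 hδ f - f)‖ := by congr 1; abel
    _ ≤ ‖mollL2 hε f - f‖ + ‖mollL2 hδ f - f‖ := norm_sub_le _ _
    _ ≤ ε * dataGradSum U₀ v + δ * dataGradSum U₀ v := add_le_add h1 h2
    _ = (ε + δ) * dataGradSum U₀ v := by ring

/-- `d_k(0) ≤ (ε + δ)² Σ_v G_v(U₀)²`. [cite: Friedrichs1954, §4] -/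
theorem diffEnergy_zero_le (k : ℕ) :
    diffEnergy h hε hδ hU₀ hU₀c Y Y' k 0 ≤ (ε + δ) ^ 2 * ∑ v ∈ wordsLE ι k, dataGradSum U₀ v ^ 2 := by
  unfold diffEnergy
  rw [Finset.mul_sum]
  refine Finset.sum_le_sum fun v _ ↦ ?_
  have hle := norm_diffCurve_zero_le h hε hδ hU₀ hU₀c (Y := Y) (Y' := Y') v
  have hεδ : 0 ≤ ε + δ := by linarith
  calc ‖diffCurve h hε hδ hU₀ hU₀c Y Y' v 0‖ ^ 2 ≤ ((ε + δ) * dataGradSum U₀ v) ^ 2 :=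
        pow_le_pow_left₀ (norm_nonneg _) hle 2
    _ = (ε + δ) ^ 2 * dataGradSum U₀ v ^ 2 := by ring

/-! ### Grönwall: the Cauchy estimate -/

/-- **The constant of the Cauchy estimate of order `k` on `[−T, T]`**, depending on the coefficient
bounds `M₀, M₁, M₂` of orders `k, k+1, k+2`, the data energies, `k`, the dimension and `T` only.
[cite: Friedrichs1954, §4] -/
def cauchyConst (ι : Type*) [Fintype ι] [DecidableEq ι] (k : ℕ) (T M₀ M₁ M₂ : ℝ)
    (U₀ : EuclideanSpace ℝ ι → W) : ℝ :=
  Real.exp ((energyRate ι k M₀ + 1) * T) *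
    ((∑ v ∈ wordsLE ι k, dataGradSum U₀ v ^ 2) +
      4 * (wordsLE ι k).card ^ 2 * (Fintype.card ι * ((Fintype.card ι + 1) * 2 ^ (k + 1) * M₁ *
        Real.sqrt (Real.exp (energyRate ι (k + 2) M₂ * T) * wordEnergy (k + 2) U₀))) ^ 2)

set_option maxHeartbeats 1000000 in
include hY0 hY hY0' hY' in
/-- **The regularised solutions are Cauchy at every order, uniformly on compact time intervals**:
`d_k(t) = Σ_{|v| ≤ k} ‖∂_v (V^ε − V^δ)(t)‖₂² ≤ (ε + δ)² C` for `|t| ≤ T`, with `C = cauchyConst k T …`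
independent of `ε, δ` (the differential inequality `|d'| ≤ K d + 2 N b √d ≤ (K + 1) d + N²b²`,
Grönwall for `d + N²b²`, and the initial bound). [cite: Friedrichs1954, §4; TaylorPDEIII2011, Ch. 16 §1 (1.15)] -/
theorem diffEnergy_le {T : ℝ} {k : ℕ} {M₀ M₁ M₂ : ℝ}
    (hM₀ : ∀ t ∈ Icc (-T) T, IsSymmCoeff k M₀ (fun j ↦ A j t) (B t))
    (hM₁ : ∀ t ∈ Icc (-T) T, IsSymmCoeff (k + 1) M₁ (fun j ↦ A j t) (B t))
    (hM₂ : ∀ t ∈ Icc (-T) T, IsSymmCoeff (k + 2) M₂ (fun j ↦ A j t) (B t)) {t : ℝ} (ht : t ∈ Icc (-T) T) :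
    diffEnergy h hε hδ hU₀ hU₀c Y Y' k t ≤ (ε + δ) ^ 2 * cauchyConst ι k T M₀ M₁ M₂ U₀ := by
  -- constants
  set S := Real.exp (energyRate ι (k + 2) M₂ * T) * wordEnergy (k + 2) U₀ with hS
  set Cb := (Fintype.card ι : ℝ) * ((Fintype.card ι + 1) * 2 ^ (k + 1) * M₁ * Real.sqrt S) with hCb
  set N : ℝ := ((wordsLE ι k).card : ℝ) with hN
  set K := energyRate ι k M₀ with hK
  set F := 4 * N ^ 2 * Cb ^ 2 * (ε + δ) ^ 2 with hF
  have hT : 0 ≤ T := by linarith [ht.1, ht.2]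
  have hM₀nn : 0 ≤ M₀ := (hM₀ 0 ⟨by linarith, hT⟩).nonneg
  have hM₁nn : 0 ≤ M₁ := (hM₁ 0 ⟨by linarith, hT⟩).nonneg
  have hK0 : 0 ≤ K := energyRate_nonneg k hM₀nn
  have hCb0 : 0 ≤ Cb := by positivity
  have hF0 : 0 ≤ F := by positivity
  -- the bounds for `ℰ_{k+2}` of both representatives
  have hSε : ∀ s ∈ Icc (-T) T, wordEnergy (k + 2) (smoothSol hε Y s) ≤ S := fun s hs ↦
    wordEnergy_smoothSol_le_exp h hε hU₀ hU₀c hY0 hY hM₂ hs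
  have hSδ : ∀ s ∈ Icc (-T) T, wordEnergy (k + 2) (smoothSol hδ Y' s) ≤ S := fun s hs ↦
    wordEnergy_smoothSol_le_exp h hδ hU₀ hU₀c hY0' hY' hM₂ hs
  -- the function `u = d + F` and its differential inequality
  set d := diffEnergy h hε hδ hU₀ hU₀c Y Y' k with hd
  set d' : ℝ → ℝ := fun s ↦ ∑ v ∈ wordsLE ι k, 2 * ⟪diffCurve h hε hδ hU₀ hU₀c Y Y' v s,
    mollL2 hε (wordForcing h hε Y v s) - mollL2 hδ (wordForcing h hδ Y' v s)⟫ with hd'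
  have hderiv : ∀ s, HasDerivAt d (d' s) s := fun s ↦ hasDerivAt_diffEnergy h hε hδ hU₀ hU₀c hY hY' k s
  have hdnn : ∀ s, 0 ≤ d s := fun s ↦ diffEnergy_nonneg h hε hδ hU₀ hU₀c k s
  have hineq : ∀ s ∈ Icc (-T) T, |d' s| ≤ (K + 1) * (d s + F) := by
    intro s hs
    have hb := abs_deriv_diffEnergy_le h hε hδ hU₀ hU₀c hY0 hY hY0' hY' (hM₀ s hs) (hM₁ s hs) (hSε s hs) (hSδ s hs)
    change |d' s| ≤ K * d s + 2 * (N * (2 * (ε + δ) * Cb) * Real.sqrt (d s)) at hb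
    have hsq : Real.sqrt (d s) ^ 2 = d s := Real.sq_sqrt (hdnn s)
    have hεδ : 0 ≤ ε + δ := by linarith
    -- AM–GM: `4 N (ε+δ) Cb √d ≤ d + 4 N² Cb² (ε+δ)²`
    have hamgm : 2 * (N * (2 * (ε + δ) * Cb) * Real.sqrt (d s)) ≤ d s + F := by
      rw [hF]
      nlinarith [sq_nonneg (Real.sqrt (d s) - 2 * N * (ε + δ) * Cb), hsq, Real.sqrt_nonneg (d s)]
    calc |d' s| ≤ K * d s + 2 * (N * (2 * (ε + δ) * Cb) * Real.sqrt (d s)) := hb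
      _ ≤ K * d s + (d s + F) := by linarith
      _ ≤ (K + 1) * (d s + F) := by nlinarith [hdnn s]
  -- Grönwall for `u = d + F`
  set u : ℝ → ℝ := fun s ↦ d s + F with hu
  have huderiv : ∀ s, HasDerivAt u (d' s) s := fun s ↦ (hderiv s).add_const F
  have hunn : ∀ s, 0 ≤ u s := fun s ↦ add_nonneg (hdnn s) hF0
  have hu0 : u 0 ≤ (ε + δ) ^ 2 * (∑ v ∈ wordsLE ι k, dataGradSum U₀ v ^ 2) + F := by
    have h0 := diffEnergy_zero_le h hε hδ hU₀ hU₀c (Y := Y) (Y' := Y') k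
    show diffEnergy h hε hδ hU₀ hU₀c Y Y' k 0 + F ≤ _
    linarith
  have hδ0 : 0 ≤ (ε + δ) ^ 2 * (∑ v ∈ wordsLE ι k, dataGradSum U₀ v ^ 2) + F := by positivity
  have hut : u t ≤ ((ε + δ) ^ 2 * (∑ v ∈ wordsLE ι k, dataGradSum U₀ v ^ 2) + F) * Real.exp ((K + 1) * T) :=
    le_mul_exp_of_abs_deriv_le huderiv (fun s hs ↦ hineq s hs) hunn hu0 (by linarith) ht
  have hdt : d t ≤ u t := le_add_of_nonneg_right hF0
  refine hdt.trans (hut.trans (le_of_eq ?_))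
  rw [cauchyConst, hF, hN, hCb, hS, hK]
  ring

include hY0 hY hY0' hY' in
/-- **The Cauchy estimate for the word energy of the difference**: `ℰ_k((V^ε − V^δ)(t)) ≤ (ε + δ)² C`
for `|t| ≤ T`. [cite: Friedrichs1954, §4] -/
theorem wordEnergy_diffSol_le {T : ℝ} {k : ℕ} {M₀ M₁ M₂ : ℝ}
    (hM₀ : ∀ t ∈ Icc (-T) T, IsSymmCoeff k M₀ (fun j ↦ A j t) (B t))
    (hM₁ : ∀ t ∈ Icc (-T) T, IsSymmCoeff (k + 1) M₁ (fun j ↦ A j t) (B t))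
    (hM₂ : ∀ t ∈ Icc (-T) T, IsSymmCoeff (k + 2) M₂ (fun j ↦ A j t) (B t)) {t : ℝ} (ht : t ∈ Icc (-T) T) :
    wordEnergy k (diffSol hε hδ Y Y' t) ≤ (ε + δ) ^ 2 * cauchyConst ι k T M₀ M₁ M₂ U₀ := by
  rw [← diffEnergy_eq_wordEnergy h hε hδ hU₀ hU₀c hY0 hY hY0' hY']
  exact diffEnergy_le h hε hδ hU₀ hU₀c hY0 hY hY0' hY' hM₀ hM₁ hM₂ ht

include hY0 hY hY0' hY' in
/-- **The Cauchy estimate for a single word derivative of the difference**: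
`‖∂_v (V^ε − V^δ)(t)‖₂² ≤ (ε + δ)² C` for `|v| ≤ k`, `|t| ≤ T`. [cite: Friedrichs1954, §4] -/
theorem l2norm_cwd_diffSol_sq_le {T : ℝ} {k : ℕ} {M₀ M₁ M₂ : ℝ}
    (hM₀ : ∀ t ∈ Icc (-T) T, IsSymmCoeff k M₀ (fun j ↦ A j t) (B t))
    (hM₁ : ∀ t ∈ Icc (-T) T, IsSymmCoeff (k + 1) M₁ (fun j ↦ A j t) (B t))
    (hM₂ : ∀ t ∈ Icc (-T) T, IsSymmCoeff (k + 2) M₂ (fun j ↦ A j t) (B t)) {t : ℝ} (ht : t ∈ Icc (-T) T)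
    {v : List ι} (hv : v.length ≤ k) :
    l2norm (cwd v (diffSol hε hδ Y Y' t)) ^ 2 ≤ (ε + δ) ^ 2 * cauchyConst ι k T M₀ M₁ M₂ U₀ :=
  (l2norm_cwd_sq_le_wordEnergy hv _).trans (wordEnergy_diffSol_le h hε hδ hU₀ hU₀c hY0 hY hY0' hY' hM₀ hM₁ hM₂ ht)

end Diff

end Literature.Analysis.PDE

end

noncomputable section

open MeasureTheory Set Function Filter Metric ContinuousLinearMap intervalIntegral
open scoped ContDiff Topology RealInnerProductSpace ENNReal NNReal Convolution

namespace Literature.Analysis.PDE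

open Literature.Analysis.FunctionSpaces

variable {ι : Type*} [Fintype ι] [DecidableEq ι]
variable {W : Type*} [NormedAddCommGroup W] [InnerProductSpace ℝ W] [CompleteSpace W]
variable {A : ι → ℝ → EuclideanSpace ℝ ι → (W →L[ℝ] W)} {B : ℝ → EuclideanSpace ℝ ι → (W →L[ℝ] W)}

/-! ### Generic tools -/

section Tools

omit [CompleteSpace W] in
/-- **Word energies of word derivatives**: `ℰ_K(∂_w f) ≤ N_K ℰ_{K + |w|}(f)` (`∂_u∂_w f = ∂_{uw} f`).
[folklore] -/
theorem wordEnergy_cwd_le (K : ℕ) (w : List ι) (f : EuclideanSpace ℝ ι → W) :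
    wordEnergy K (cwd w f) ≤ (wordsLE ι K).card * wordEnergy (K + w.length) f := by
  unfold wordEnergy
  have hterm : ∀ u ∈ wordsLE ι K, l2norm (cwd u (cwd w f)) ^ 2 ≤
      ∑ v ∈ wordsLE ι (K + w.length), l2norm (cwd v f) ^ 2 := by
    intro u hu
    rw [← cwd_append]
    exact l2norm_cwd_sq_le_wordEnergy (by simp; exact mem_wordsLE.1 hu) f
  calc ∑ u ∈ wordsLE ι K, l2norm (cwd u (cwd w f)) ^ 2
      ≤ ∑ _u ∈ wordsLE ι K, ∑ v ∈ wordsLE ι (K + w.length), l2norm (cwd v f) ^ 2 :=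
        Finset.sum_le_sum hterm
    _ = _ := by rw [Finset.sum_const, nsmul_eq_mul]

omit [CompleteSpace W] in
/-- **The sup bound for a word derivative through the word energy**: for a smooth field all of whose
word derivatives are bounded and square integrable,
`‖∂_w f(x)‖² ≤ C_sup N_K ℰ_{K+|w|}(f)`, `K = 2(n+1)`. [cite: Evans2010, §5.6.3 Thm. 6] -/
theorem norm_cwd_sq_le_wordEnergy [FiniteDimensional ℝ W] {f : EuclideanSpace ℝ ι → W}
    (hf : ContDiff ℝ ∞ f) (hb : ∀ u : List ι, ∃ C : ℝ, ∀ x, ‖cwd u f x‖ ≤ C)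
    (hm : ∀ u : List ι, MemLp (cwd u f) 2 (volume : Measure (EuclideanSpace ℝ ι))) (w : List ι)
    (x : EuclideanSpace ℝ ι) :
    ‖cwd w f x‖ ^ 2 ≤ supConst ι W * ((wordsLE ι (2 * (Fintype.card ι + 1))).card *
      wordEnergy (2 * (Fintype.card ι + 1) + w.length) f) := by
  have h1 := norm_sq_le_supConst_mul_wordEnergy (ι := ι) (W := W) (f := cwd w f) (contDiff_cwd hf w)
    (fun u ↦ by obtain ⟨C, hC⟩ := hb (u ++ w); exact ⟨C, fun x ↦ by rw [← cwd_append]; exact hC x⟩)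
    (fun u ↦ by rw [← cwd_append]; exact hm (u ++ w)) x
  exact h1.trans (mul_le_mul_of_nonneg_left (wordEnergy_cwd_le _ w f) supConst_nonneg)

variable {ρ : EuclideanSpace ℝ ι → ℝ}

omit [DecidableEq ι] [CompleteSpace W] in
/-- **Joint continuity of mollified continuous `L²`-valued curves**: for `Y : ℝ → L²` continuous
and a smooth compactly supported kernel, `(t, x) ↦ (ρ ⋆ Y t)(x)` is continuous.
[cite: Friedrichs1954, §4] -/
theorem continuous_smoothRep_uncurry (hρ : ContDiff ℝ ∞ ρ) (hρc : HasCompactSupport ρ)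
    {Y : ℝ → Lp W 2 (volume : Measure (EuclideanSpace ℝ ι))} (hY : Continuous Y) :
    Continuous fun p : ℝ × EuclideanSpace ℝ ι ↦ smoothRep ρ (Y p.1) p.2 := by
  refine continuous_iff_continuousAt.2 fun p₀ ↦ ?_
  rw [ContinuousAt, tendsto_iff_norm_sub_tendsto_zero]
  have hbound : ∀ p : ℝ × EuclideanSpace ℝ ι, ‖smoothRep ρ (Y p.1) p.2 - smoothRep ρ (Y p₀.1) p₀.2‖ ≤
      l2norm (cwd [] ρ) * ‖Y p.1 - Y p₀.1‖ + ‖smoothRep ρ (Y p₀.1) p.2 - smoothRep ρ (Y p₀.1) p₀.2‖ := by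
    intro p
    have hsplit : smoothRep ρ (Y p.1) p.2 - smoothRep ρ (Y p₀.1) p₀.2 =
        smoothRep ρ (Y p.1 - Y p₀.1) p.2 + (smoothRep ρ (Y p₀.1) p.2 - smoothRep ρ (Y p₀.1) p₀.2) := by
      rw [smoothRep_sub ρ hρ.continuous hρc, Pi.sub_apply]; abel
    rw [hsplit]
    refine (norm_add_le _ _).trans (add_le_add ?_ le_rfl)
    exact norm_cwd_smoothRep_le hρ hρc (Y p.1 - Y p₀.1) [] p.2
  have hlim : Tendsto (fun p : ℝ × EuclideanSpace ℝ ι ↦ l2norm (cwd [] ρ) * ‖Y p.1 - Y p₀.1‖ +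
      ‖smoothRep ρ (Y p₀.1) p.2 - smoothRep ρ (Y p₀.1) p₀.2‖) (𝓝 p₀) (𝓝 0) := by
    have h1 : Tendsto (fun p : ℝ × EuclideanSpace ℝ ι ↦ ‖Y p.1 - Y p₀.1‖) (𝓝 p₀) (𝓝 0) := by
      have hc : Continuous fun p : ℝ × EuclideanSpace ℝ ι ↦ ‖Y p.1 - Y p₀.1‖ :=
        ((hY.comp continuous_fst).sub continuous_const).norm
      simpa using hc.tendsto p₀
    have h2 : Tendsto (fun p : ℝ × EuclideanSpace ℝ ι ↦ ‖smoothRep ρ (Y p₀.1) p.2 - smoothRep ρ (Y p₀.1) p₀.2‖)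
        (𝓝 p₀) (𝓝 0) := by
      have hc : Continuous fun p : ℝ × EuclideanSpace ℝ ι ↦ ‖smoothRep ρ (Y p₀.1) p.2 - smoothRep ρ (Y p₀.1) p₀.2‖ :=
        (((contDiff_smoothRep hρ hρc (Y p₀.1)).continuous.comp continuous_snd).sub continuous_const).norm
      simpa using hc.tendsto p₀
    simpa using (h1.const_mul (l2norm (cwd [] ρ))).add h2
  exact squeeze_zero' (Eventually.of_forall fun p ↦ norm_nonneg _) (Eventually.of_forall hbound) hlim

end Tools

/-! ### The approximating solutions along `ε_m = 1/(m+1)` -/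

section Approx

/-- The scales `ε_m = 1/(m + 1)`. [cite: Friedrichs1954, §4] -/
def scale (m : ℕ) : ℝ := 1 / ((m : ℝ) + 1)

/-- `0 < ε_m`. [folklore] -/
theorem scale_pos (m : ℕ) : 0 < scale m := by unfold scale; positivity

/-- `ε_m → 0`. [folklore] -/
theorem tendsto_scale : Tendsto scale atTop (𝓝 0) := tendsto_one_div_add_atTop_nhds_zero_nat

/-- `ε_m` is antitone. [folklore] -/
theorem scale_antitone : Antitone scale := fun m n hmn ↦ by
  unfold scale
  exact one_div_le_one_div_of_le (by positivity) (by exact_mod_cast Nat.add_le_add_right hmn 1)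

variable (h : IsRegularSymmCoeffFamily A B)
variable {U₀ : EuclideanSpace ℝ ι → W} (hU₀ : ContDiff ℝ ∞ U₀) (hU₀c : HasCompactSupport U₀)

omit [DecidableEq ι] [InnerProductSpace ℝ W] [CompleteSpace W] in
/-- The data as an element of `L²`. [folklore] -/
theorem memLp_data [NormedSpace ℝ W] {U₀ : EuclideanSpace ℝ ι → W} (hU₀ : ContDiff ℝ ∞ U₀)
    (hU₀c : HasCompactSupport U₀) : MemLp U₀ 2 (volume : Measure (EuclideanSpace ℝ ι)) :=
  hU₀.continuous.memLp_of_hasCompactSupport hU₀c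

/-- **The approximating regularised solutions** `Y_m : ℝ → L²` of scale `ε_m` with data `U₀`.
[cite: Friedrichs1954, §4] -/
def approxSol (m : ℕ) : ℝ → Lp W 2 (volume : Measure (EuclideanSpace ℝ ι)) :=
  Classical.choose (exists_regSolution h (scale_pos m) ((memLp_data hU₀ hU₀c).toLp U₀))

omit [DecidableEq ι] in
/-- `Y_m(0) = [U₀]`. [cite: Friedrichs1954, §4] -/
theorem approxSol_zero (m : ℕ) : approxSol h hU₀ hU₀c m 0 = (memLp_data hU₀ hU₀c).toLp U₀ :=
  (Classical.choose_spec (exists_regSolution h (scale_pos m) ((memLp_data hU₀ hU₀c).toLp U₀))).1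

omit [DecidableEq ι] in
/-- `Y_m' = J 𝒫 (ρ ⋆ Y_m)`. [cite: Friedrichs1954, §4] -/
theorem approxSol_deriv (m : ℕ) (t : ℝ) :
    HasDerivAt (approxSol h hU₀ hU₀c m) (regField h (scale_pos m) t (approxSol h hU₀ hU₀c m t)) t :=
  (Classical.choose_spec (exists_regSolution h (scale_pos m) ((memLp_data hU₀ hU₀c).toLp U₀))).2 t

omit [DecidableEq ι] in
/-- `Y_m` is continuous. [folklore] -/
theorem continuous_approxSol (m : ℕ) : Continuous (approxSol h hU₀ hU₀c m) :=
  continuous_of_regSolution h (scale_pos m) (approxSol_deriv h hU₀ hU₀c m)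

/-- **The approximating smooth solutions** `V_m(t) = ρ_{ε_m} ⋆ Y_m(t)`. [cite: Friedrichs1954, §4] -/
def approx (m : ℕ) (t : ℝ) : EuclideanSpace ℝ ι → W := smoothSol (scale_pos m) (approxSol h hU₀ hU₀c m) t

omit [DecidableEq ι] in
/-- Unfolding of `approx`. [cite: Friedrichs1954, §4] -/
theorem approx_def (m : ℕ) (t : ℝ) :
    approx h hU₀ hU₀c m t = smoothRep (moll ι (scale_pos m)) (approxSol h hU₀ hU₀c m t) := rfl

omit [DecidableEq ι] in
/-- The approximating solutions are smooth in space. [cite: Friedrichs1954, §4] -/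
theorem contDiff_approx (m : ℕ) (t : ℝ) : ContDiff ℝ ∞ (approx h hU₀ hU₀c m t) :=
  contDiff_smoothSol (scale_pos m) _ t

omit [DecidableEq ι] in
/-- Word derivatives of the approximating solutions are bounded (crudely, for fixed `m, t`).
[folklore] -/
theorem exists_norm_cwd_approx_le_crude (m : ℕ) (t : ℝ) (u : List ι) :
    ∃ C : ℝ, ∀ x, ‖cwd u (approx h hU₀ hU₀c m t) x‖ ≤ C :=
  ⟨_, fun x ↦ norm_cwd_smoothRep_le (contDiff_moll (scale_pos m)) (hasCompactSupport_moll (scale_pos m)) _ u x⟩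

omit [DecidableEq ι] in
/-- Word derivatives of the approximating solutions are square integrable. [folklore] -/
theorem memLp_cwd_approx (m : ℕ) (t : ℝ) (u : List ι) :
    MemLp (cwd u (approx h hU₀ hU₀c m t)) 2 (volume : Measure (EuclideanSpace ℝ ι)) :=
  (memLp_cwd_smoothRep (contDiff_moll (scale_pos m)) (hasCompactSupport_moll (scale_pos m)) _ u).1

omit [DecidableEq ι] in
/-- `(t, x) ↦ ∂_w V_m(t)(x)` is continuous. [cite: Friedrichs1954, §4] -/
theorem continuous_cwd_approx_uncurry (m : ℕ) (w : List ι) :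
    Continuous fun p : ℝ × EuclideanSpace ℝ ι ↦ cwd w (approx h hU₀ hU₀c m p.1) p.2 := by
  have hρ := contDiff_moll (ι := ι) (scale_pos m)
  have hρc := hasCompactSupport_moll (ι := ι) (scale_pos m)
  have heq : (fun p : ℝ × EuclideanSpace ℝ ι ↦ cwd w (approx h hU₀ hU₀c m p.1) p.2) =
      fun p ↦ smoothRep (cwd w (moll ι (scale_pos m))) (approxSol h hU₀ hU₀c m p.1) p.2 := by
    funext p; rw [approx_def, cwd_smoothRep hρ hρc]
  rw [heq]
  exact continuous_smoothRep_uncurry (contDiff_cwd hρ w) (hasCompactSupport_cwd hρc w) (continuous_approxSol h hU₀ hU₀c m)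

/-! ### Uniform bounds -/

/-- **Uniform energy bounds**: `ℰ_k(V_m(t)) ≤ C` for `|t| ≤ T`, all `m`. [cite: Friedrichs1954, §4] -/
theorem exists_wordEnergy_approx_le (T : ℝ) (k : ℕ) :
    ∃ C, 0 ≤ C ∧ ∀ m, ∀ t ∈ Icc (-T) T, wordEnergy k (approx h hU₀ hU₀c m t) ≤ C := by
  obtain ⟨M, hM⟩ := h.coeff T k
  refine ⟨Real.exp (energyRate ι k M * T) * wordEnergy k U₀,
    mul_nonneg (Real.exp_pos _).le (wordEnergy_nonneg k U₀), fun m t ht ↦ ?_⟩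
  exact wordEnergy_smoothSol_le_exp h (scale_pos m) hU₀ hU₀c (approxSol_zero h hU₀ hU₀c m) (approxSol_deriv h hU₀ hU₀c m) hM ht

/-- **Uniform sup bounds for the word derivatives of the approximating solutions**:
`‖∂_w V_m(t)(x)‖ ≤ C` for `|t| ≤ T`, all `m` and `x`. [cite: Friedrichs1954, §4] -/
theorem exists_norm_cwd_approx_le [FiniteDimensional ℝ W] (T : ℝ) (w : List ι) :
    ∃ C, 0 ≤ C ∧ ∀ m, ∀ t ∈ Icc (-T) T, ∀ x, ‖cwd w (approx h hU₀ hU₀c m t) x‖ ≤ C := by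
  obtain ⟨C, hC0, hC⟩ := exists_wordEnergy_approx_le h hU₀ hU₀c T (2 * (Fintype.card ι + 1) + w.length)
  refine ⟨Real.sqrt (supConst ι W * ((wordsLE ι (2 * (Fintype.card ι + 1))).card * C)), Real.sqrt_nonneg _,
    fun m t ht x ↦ ?_⟩
  refine Real.le_sqrt_of_sq_le ?_
  refine (norm_cwd_sq_le_wordEnergy (contDiff_approx h hU₀ hU₀c m t)
    (exists_norm_cwd_approx_le_crude h hU₀ hU₀c m t) (memLp_cwd_approx h hU₀ hU₀c m t) w x).trans ?_
  exact mul_le_mul_of_nonneg_left (mul_le_mul_of_nonneg_left (hC m t ht) (Nat.cast_nonneg _)) supConst_nonneg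

/-- **Uniform Cauchy bounds for the word derivatives of the approximating solutions**:
`‖∂_w V_m(t)(x) − ∂_w V_{m'}(t)(x)‖ ≤ C (ε_m + ε_{m'})` for `|t| ≤ T`. [cite: Friedrichs1954, §4] -/
theorem exists_norm_cwd_approx_sub_le [FiniteDimensional ℝ W] (T : ℝ) (w : List ι) :
    ∃ C, 0 ≤ C ∧ ∀ m m', ∀ t ∈ Icc (-T) T, ∀ x,
      ‖cwd w (approx h hU₀ hU₀c m t) x - cwd w (approx h hU₀ hU₀c m' t) x‖ ≤ C * (scale m + scale m') := by
  set k := 2 * (Fintype.card ι + 1) + w.length with hk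
  obtain ⟨M₀, hM₀⟩ := h.coeff T k
  obtain ⟨M₁, hM₁⟩ := h.coeff T (k + 1)
  obtain ⟨M₂, hM₂⟩ := h.coeff T (k + 2)
  set Cc := cauchyConst ι k T M₀ M₁ M₂ U₀ with hCc
  set N : ℝ := ((wordsLE ι (2 * (Fintype.card ι + 1))).card : ℝ) with hN
  refine ⟨Real.sqrt (supConst ι W * (N * |Cc|)), Real.sqrt_nonneg _, fun m m' t ht x ↦ ?_⟩
  -- the difference of the two approximations is `diffSol`
  have hdiff : cwd w (approx h hU₀ hU₀c m t) x - cwd w (approx h hU₀ hU₀c m' t) x =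
      cwd w (diffSol (scale_pos m) (scale_pos m') (approxSol h hU₀ hU₀c m) (approxSol h hU₀ hU₀c m') t) x := by
    rw [cwd_diffSol]; rfl
  rw [hdiff]
  have hD : ContDiff ℝ ∞ (diffSol (scale_pos m) (scale_pos m') (approxSol h hU₀ hU₀c m) (approxSol h hU₀ hU₀c m') t) :=
    (contDiff_approx h hU₀ hU₀c m t).sub (contDiff_approx h hU₀ hU₀c m' t)
  have hb : ∀ u : List ι, ∃ C : ℝ, ∀ x,
      ‖cwd u (diffSol (scale_pos m) (scale_pos m') (approxSol h hU₀ hU₀c m) (approxSol h hU₀ hU₀c m') t) x‖ ≤ C := by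
    intro u
    obtain ⟨C1, hC1⟩ := exists_norm_cwd_approx_le_crude h hU₀ hU₀c m t u
    obtain ⟨C2, hC2⟩ := exists_norm_cwd_approx_le_crude h hU₀ hU₀c m' t u
    refine ⟨C1 + C2, fun y ↦ ?_⟩
    rw [cwd_diffSol]
    exact (norm_sub_le _ _).trans (add_le_add (hC1 y) (hC2 y))
  have hm : ∀ u : List ι, MemLp (cwd u (diffSol (scale_pos m) (scale_pos m') (approxSol h hU₀ hU₀c m)
      (approxSol h hU₀ hU₀c m') t)) 2 (volume : Measure (EuclideanSpace ℝ ι)) := fun u ↦ by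
    rw [cwd_diffSol]; exact (memLp_cwd_approx h hU₀ hU₀c m t u).sub (memLp_cwd_approx h hU₀ hU₀c m' t u)
  have hsq := norm_cwd_sq_le_wordEnergy hD hb hm w x
  have hE := wordEnergy_diffSol_le h (scale_pos m) (scale_pos m') hU₀ hU₀c (approxSol_zero h hU₀ hU₀c m)
    (approxSol_deriv h hU₀ hU₀c m) (approxSol_zero h hU₀ hU₀c m') (approxSol_deriv h hU₀ hU₀c m') hM₀ hM₁ hM₂ ht
  have hεδ : 0 ≤ scale m + scale m' := (add_pos (scale_pos m) (scale_pos m')).le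
  have hC0 : 0 ≤ supConst ι W := supConst_nonneg
  have hN0 : 0 ≤ N := by positivity
  have hbound : ‖cwd w (diffSol (scale_pos m) (scale_pos m') (approxSol h hU₀ hU₀c m) (approxSol h hU₀ hU₀c m') t) x‖ ^ 2 ≤
      (Real.sqrt (supConst ι W * (N * |Cc|)) * (scale m + scale m')) ^ 2 := by
    rw [mul_pow, Real.sq_sqrt (mul_nonneg hC0 (mul_nonneg hN0 (abs_nonneg _)))]
    refine hsq.trans ?_
    rw [← hk, ← hN]
    calc supConst ι W * (N * wordEnergy k (diffSol (scale_pos m) (scale_pos m') (approxSol h hU₀ hU₀c m)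
          (approxSol h hU₀ hU₀c m') t))
        ≤ supConst ι W * (N * ((scale m + scale m') ^ 2 * |Cc|)) := by
          refine mul_le_mul_of_nonneg_left (mul_le_mul_of_nonneg_left (hE.trans ?_) hN0) hC0
          exact mul_le_mul_of_nonneg_left (le_abs_self _) (sq_nonneg _)
      _ = supConst ι W * (N * |Cc|) * (scale m + scale m') ^ 2 := by ring
  have hCs : 0 ≤ Real.sqrt (supConst ι W * (N * |Cc|)) * (scale m + scale m') := mul_nonneg (Real.sqrt_nonneg _) hεδ
  exact (pow_le_pow_iff_left₀ (norm_nonneg _) hCs two_ne_zero).1 hbound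

/-! ### The limit fields -/

/-- **The limit fields** `limField w t x = lim_m ∂_w V_m(t)(x)`. [cite: Friedrichs1954, §4] -/
def limField (w : List ι) (t : ℝ) (x : EuclideanSpace ℝ ι) : W :=
  limUnder atTop fun m ↦ cwd w (approx h hU₀ hU₀c m t) x

/-- **Pointwise convergence**: `∂_w V_m(t)(x) → limField w t x`. [cite: Friedrichs1954, §4] -/
theorem tendsto_limField [FiniteDimensional ℝ W] (w : List ι) (t : ℝ) (x : EuclideanSpace ℝ ι) :
    Tendsto (fun m ↦ cwd w (approx h hU₀ hU₀c m t) x) atTop (𝓝 (limField h hU₀ hU₀c w t x)) := by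
  obtain ⟨C, hC0, hC⟩ := exists_norm_cwd_approx_sub_le h hU₀ hU₀c |t| w
  have ht : t ∈ Icc (-|t|) |t| := ⟨neg_abs_le t, le_abs_self t⟩
  have hcauchy : CauchySeq fun m ↦ cwd w (approx h hU₀ hU₀c m t) x := by
    refine cauchySeq_of_le_tendsto_0' (fun m ↦ C * (2 * scale m)) (fun n m hnm ↦ ?_) ?_
    · rw [dist_eq_norm]
      refine (hC n m t ht x).trans (mul_le_mul_of_nonneg_left ?_ hC0)
      linarith [scale_antitone hnm]
    · simpa using (tendsto_scale.const_mul 2).const_mul C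
  exact hcauchy.tendsto_limUnder

/-- **Uniform convergence with rate**: `‖∂_w V_m(t)(x) − limField w t x‖ ≤ C ε_m` for `|t| ≤ T`.
[cite: Friedrichs1954, §4] -/
theorem exists_norm_cwd_approx_sub_limField_le [FiniteDimensional ℝ W] (T : ℝ) (w : List ι) :
    ∃ C, 0 ≤ C ∧ ∀ m, ∀ t ∈ Icc (-T) T, ∀ x,
      ‖cwd w (approx h hU₀ hU₀c m t) x - limField h hU₀ hU₀c w t x‖ ≤ C * scale m := by
  obtain ⟨C, hC0, hC⟩ := exists_norm_cwd_approx_sub_le h hU₀ hU₀c T w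
  refine ⟨C, hC0, fun m t ht x ↦ ?_⟩
  have hlim : Tendsto (fun m' ↦ ‖cwd w (approx h hU₀ hU₀c m t) x - cwd w (approx h hU₀ hU₀c m' t) x‖) atTop
      (𝓝 ‖cwd w (approx h hU₀ hU₀c m t) x - limField h hU₀ hU₀c w t x‖) :=
    (tendsto_const_nhds.sub (tendsto_limField h hU₀ hU₀c w t x)).norm
  have hbd : Tendsto (fun m' ↦ C * (scale m + scale m')) atTop (𝓝 (C * scale m)) := by
    simpa using (tendsto_const_nhds.add tendsto_scale).const_mul C
  exact le_of_tendsto_of_tendsto' hlim hbd fun m' ↦ hC m m' t ht x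

/-- **Uniform convergence** of `(t, x) ↦ ∂_w V_m(t)(x)` to `limField w` on `[−T, T] × ℝⁿ`.
[cite: Friedrichs1954, §4] -/
theorem tendstoUniformlyOn_limField [FiniteDimensional ℝ W] (T : ℝ) (w : List ι) :
    TendstoUniformlyOn (fun m (p : ℝ × EuclideanSpace ℝ ι) ↦ cwd w (approx h hU₀ hU₀c m p.1) p.2)
      (fun p ↦ limField h hU₀ hU₀c w p.1 p.2) atTop (Icc (-T) T ×ˢ univ) := by
  obtain ⟨C, hC0, hC⟩ := exists_norm_cwd_approx_sub_limField_le h hU₀ hU₀c T w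
  refine Metric.tendstoUniformlyOn_iff.2 fun ε hε ↦ ?_
  have hev : ∀ᶠ m in atTop, C * scale m < ε := by
    have ht : Tendsto (fun m ↦ C * scale m) atTop (𝓝 0) := by simpa using tendsto_scale.const_mul C
    exact ht.eventually (gt_mem_nhds hε)
  filter_upwards [hev] with m hm p hp
  rw [dist_comm, dist_eq_norm]
  exact (hC m p.1 (mem_prod.1 hp).1 p.2).trans_lt hm

/-- **The limit fields are continuous** in `(t, x)`. [cite: Friedrichs1954, §4] -/
theorem continuous_limField [FiniteDimensional ℝ W] (w : List ι) :
    Continuous fun p : ℝ × EuclideanSpace ℝ ι ↦ limField h hU₀ hU₀c w p.1 p.2 := by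
  refine continuous_iff_continuousAt.2 fun p₀ ↦ ?_
  set T := |p₀.1| + 1 with hT
  have hcont : ContinuousOn (fun p : ℝ × EuclideanSpace ℝ ι ↦ limField h hU₀ hU₀c w p.1 p.2) (Icc (-T) T ×ˢ univ) :=
    (tendstoUniformlyOn_limField h hU₀ hU₀c T w).continuousOn
      (Frequently.of_forall fun m ↦ (continuous_cwd_approx_uncurry h hU₀ hU₀c m w).continuousOn)
  refine hcont.continuousAt (prod_mem_nhds (Icc_mem_nhds ?_ ?_) univ_mem)
  · rw [hT]; linarith [neg_abs_le p₀.1]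
  · rw [hT]; linarith [le_abs_self p₀.1]

/-- The limit fields are continuous in `x` for fixed `t`. [folklore] -/
theorem continuous_limField_slice [FiniteDimensional ℝ W] (w : List ι) (t : ℝ) :
    Continuous (limField h hU₀ hU₀c w t) := by
  have hp : Continuous fun x : EuclideanSpace ℝ ι ↦ (t, x) := continuous_const.prodMk continuous_id
  have hc := (continuous_limField h hU₀ hU₀c w).comp hp
  exact hc.congr fun x ↦ rfl

/-- **Uniform bounds pass to the limit**: `‖limField w t x‖ ≤ C` for `|t| ≤ T`. [cite: Friedrichs1954, §4] -/
theorem exists_norm_limField_le [FiniteDimensional ℝ W] (T : ℝ) (w : List ι) :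
    ∃ C, 0 ≤ C ∧ ∀ t ∈ Icc (-T) T, ∀ x, ‖limField h hU₀ hU₀c w t x‖ ≤ C := by
  obtain ⟨C, hC0, hC⟩ := exists_norm_cwd_approx_le h hU₀ hU₀c T w
  exact ⟨C, hC0, fun t ht x ↦ le_of_tendsto' (tendsto_limField h hU₀ hU₀c w t x).norm fun m ↦ hC m t ht x⟩

/-! ### Spatial derivatives of the limit -/

/-- **The limit fields are differentiable in space, with derivative built from the limit fields of
the longer words**: `D(limField w t)(x) = Σⱼ dxʲ ⊗ limField (j :: w) t x` (uniform convergence of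
the derivatives `∂ⱼ∂_w V_m = ∂_{j::w} V_m`). [cite: Friedrichs1954, §4] -/
theorem hasFDerivAt_limField [FiniteDimensional ℝ W] (w : List ι) (t : ℝ) (x : EuclideanSpace ℝ ι) :
    HasFDerivAt (limField h hU₀ hU₀c w t)
      (∑ j, (EuclideanSpace.proj (𝕜 := ℝ) j).smulRight (limField h hU₀ hU₀c (j :: w) t x)) x := by
  set f : ℕ → EuclideanSpace ℝ ι → W := fun m ↦ cwd w (approx h hU₀ hU₀c m t) with hf
  set f' : ℕ → EuclideanSpace ℝ ι → (EuclideanSpace ℝ ι →L[ℝ] W) := fun m y ↦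
    ∑ j, (EuclideanSpace.proj (𝕜 := ℝ) j).smulRight (cwd (j :: w) (approx h hU₀ hU₀c m t) y) with hf'
  set g' : EuclideanSpace ℝ ι → (EuclideanSpace ℝ ι →L[ℝ] W) := fun y ↦
    ∑ j, (EuclideanSpace.proj (𝕜 := ℝ) j).smulRight (limField h hU₀ hU₀c (j :: w) t y) with hg'
  have hderiv : ∀ m y, HasFDerivAt (f m) (f' m y) y := by
    intro m y
    have hd : DifferentiableAt ℝ (f m) y :=
      ((contDiff_cwd (contDiff_approx h hU₀ hU₀c m t) w).differentiable (by simp)) y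
    have h1 := hd.hasFDerivAt
    rw [fderiv_eq_sum_smulRight] at h1
    exact h1
  have hunif : TendstoUniformly f' g' atTop := by
    have ht : t ∈ Icc (-|t|) |t| := ⟨neg_abs_le t, le_abs_self t⟩
    -- rate for each `j`
    have hrate : ∀ j, ∃ C, 0 ≤ C ∧ ∀ m y, ‖cwd (j :: w) (approx h hU₀ hU₀c m t) y -
        limField h hU₀ hU₀c (j :: w) t y‖ ≤ C * scale m := by
      intro j
      obtain ⟨C, hC0, hC⟩ := exists_norm_cwd_approx_sub_limField_le h hU₀ hU₀c |t| (j :: w)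
      exact ⟨C, hC0, fun m y ↦ hC m t ht y⟩
    choose C hC0 hC using hrate
    refine Metric.tendstoUniformly_iff.2 fun ε hε ↦ ?_
    have hev : ∀ᶠ m in atTop, (∑ j, C j) * scale m < ε := by
      have hl : Tendsto (fun m ↦ (∑ j, C j) * scale m) atTop (𝓝 0) := by
        simpa using tendsto_scale.const_mul (∑ j, C j)
      exact hl.eventually (gt_mem_nhds hε)
    filter_upwards [hev] with m hm y
    rw [dist_comm, dist_eq_norm]
    show ‖(∑ j, (EuclideanSpace.proj (𝕜 := ℝ) j).smulRight (cwd (j :: w) (approx h hU₀ hU₀c m t) y)) -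
      ∑ j, (EuclideanSpace.proj (𝕜 := ℝ) j).smulRight (limField h hU₀ hU₀c (j :: w) t y)‖ < ε
    rw [← Finset.sum_sub_distrib]
    have hm' : ∑ j, C j * scale m < ε := by rwa [← Finset.sum_mul]
    refine lt_of_le_of_lt ((norm_sum_le _ _).trans (Finset.sum_le_sum fun j _ ↦ ?_)) hm'
    have hlin : (EuclideanSpace.proj (𝕜 := ℝ) j).smulRight (cwd (j :: w) (approx h hU₀ hU₀c m t) y) -
        (EuclideanSpace.proj (𝕜 := ℝ) j).smulRight (limField h hU₀ hU₀c (j :: w) t y) =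
        (EuclideanSpace.proj (𝕜 := ℝ) j).smulRight
          (cwd (j :: w) (approx h hU₀ hU₀c m t) y - limField h hU₀ hU₀c (j :: w) t y) := by
      ext z; simp [smul_sub]
    rw [hlin, norm_smulRight_apply]
    have hproj : ‖EuclideanSpace.proj (𝕜 := ℝ) j‖ ≤ 1 :=
      (EuclideanSpace.proj (𝕜 := ℝ) j).opNorm_le_bound zero_le_one fun z ↦ by
        rw [one_mul]; exact PiLp.norm_apply_le z j
    calc ‖EuclideanSpace.proj (𝕜 := ℝ) j‖ * ‖cwd (j :: w) (approx h hU₀ hU₀c m t) y - limField h hU₀ hU₀c (j :: w) t y‖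
        ≤ 1 * (C j * scale m) := mul_le_mul hproj (hC j m y) (norm_nonneg _) zero_le_one
      _ = C j * scale m := one_mul _
  exact hasFDerivAt_of_tendstoUniformly hunif hderiv (fun y ↦ tendsto_limField h hU₀ hU₀c w t y) x

/-- Partial derivatives of the limit fields: `∂ⱼ (limField w t) = limField (j :: w) t`.
[cite: Friedrichs1954, §4] -/
theorem fderiv_limField_apply_bv [FiniteDimensional ℝ W] (w : List ι) (t : ℝ) (x : EuclideanSpace ℝ ι) (j : ι) :
    fderiv ℝ (limField h hU₀ hU₀c w t) x (bv j) = limField h hU₀ hU₀c (j :: w) t x := by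
  rw [(hasFDerivAt_limField h hU₀ hU₀c w t x).fderiv]
  simp [ContinuousLinearMap.smulRight_apply, bv, PiLp.single_apply]

/-- **Word derivatives of the limit are the limit fields**: `∂_u (limField w t) = limField (u ++ w) t`.
[cite: Friedrichs1954, §4] -/
theorem cwd_limField [FiniteDimensional ℝ W] (u w : List ι) (t : ℝ) :
    cwd u (limField h hU₀ hU₀c w t) = limField h hU₀ hU₀c (u ++ w) t := by
  induction u with
  | nil => rfl
  | cons j u ih =>
    funext x
    rw [cwd_cons, ih, List.cons_append]
    exact fderiv_limField_apply_bv h hU₀ hU₀c (u ++ w) t x j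

/-- **The limit is smooth in space**: `limField w t ∈ C^∞(ℝⁿ; W)`. [cite: Friedrichs1954, §4] -/
theorem contDiff_limField [FiniteDimensional ℝ W] (w : List ι) (t : ℝ) :
    ContDiff ℝ ∞ (limField h hU₀ hU₀c w t) := by
  suffices hn : ∀ n : ℕ, ∀ w : List ι, ContDiff ℝ n (limField h hU₀ hU₀c w t) from
    contDiff_infty.2 fun n ↦ hn n w
  intro n
  induction n with
  | zero => exact fun w ↦ contDiff_zero.2 (continuous_limField_slice h hU₀ hU₀c w t)
  | succ n ih =>
    intro w
    have hdf : fderiv ℝ (limField h hU₀ hU₀c w t) =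
        fun x ↦ ∑ j, (EuclideanSpace.proj (𝕜 := ℝ) j).smulRight (limField h hU₀ hU₀c (j :: w) t x) :=
      funext fun x ↦ (hasFDerivAt_limField h hU₀ hU₀c w t x).fderiv
    refine (contDiff_succ_iff_fderiv (n := n)).2 ⟨fun x ↦ (hasFDerivAt_limField h hU₀ hU₀c w t x).differentiableAt,
      fun hω ↦ ?_, ?_⟩
    · exact absurd hω (by simp)
    · rw [hdf]
      refine ContDiff.sum fun j _ ↦ ?_
      exact (ContinuousLinearMap.smulRightL ℝ (EuclideanSpace ℝ ι) W (EuclideanSpace.proj (𝕜 := ℝ) j)).contDiff.comp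
        (ih (j :: w))

end Approx

end Literature.Analysis.PDE

end

noncomputable section

open MeasureTheory Set Function Filter Metric ContinuousLinearMap intervalIntegral
open scoped ContDiff Topology RealInnerProductSpace ENNReal NNReal Convolution

namespace Literature.Analysis.PDE

open Literature.Analysis.FunctionSpaces

variable {ι : Type*} [Fintype ι] [DecidableEq ι]
variable {W : Type*} [NormedAddCommGroup W] [InnerProductSpace ℝ W] [CompleteSpace W]
variable {A : ι → ℝ → EuclideanSpace ℝ ι → (W →L[ℝ] W)} {B : ℝ → EuclideanSpace ℝ ι → (W →L[ℝ] W)}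

/-! ### Generic tools -/

section Tools

omit [DecidableEq ι] in
/-- **Sup bound for the double mollification**: `‖J_ε²f(x)‖ ≤ K` if `‖f‖ ≤ K`. [folklore] -/
theorem norm_moll2_le {ε : ℝ} (hε : 0 < ε) {f : EuclideanSpace ℝ ι → W} (hf : Continuous f) {K : ℝ}
    (hK : ∀ y, ‖f y‖ ≤ K) (x : EuclideanSpace ℝ ι) : ‖moll2 hε f x‖ ≤ K := by
  have hρ := continuous_moll (ι := ι) hε
  have hρc := hasCompactSupport_moll (ι := ι) hε
  have h1 : ∀ y, ‖(moll ι hε ⋆[lsmul ℝ ℝ, volume] f) y‖ ≤ K := fun y ↦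
    norm_normed_convolution_le (bump ι hε) hf fun z _ ↦ hK z
  have hc : Continuous (moll ι hε ⋆[lsmul ℝ ℝ, volume] f) :=
    hρc.continuous_convolution_left _ hρ hf.locallyIntegrable
  exact norm_normed_convolution_le (bump ι hε) hc fun z _ ↦ h1 z

omit [DecidableEq ι] in
/-- **Sup rate of the double mollification**: `‖J_ε²g(x) − g(x)‖ ≤ 2 ε K` if `‖∇g‖ ≤ K`.
[cite: Friedrichs1954, §4] -/
theorem norm_moll2_sub_self_le {ε : ℝ} (hε : 0 < ε) {g : EuclideanSpace ℝ ι → W} (hg : ContDiff ℝ 1 g) {K : ℝ}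
    (hK : ∀ y, ‖fderiv ℝ g y‖ ≤ K) (x : EuclideanSpace ℝ ι) : ‖moll2 hε g x - g x‖ ≤ 2 * ε * K := by
  have hρ := continuous_moll (ι := ι) hε
  have hρc := hasCompactSupport_moll (ι := ι) hε
  have hJg : Continuous (moll ι hε ⋆[lsmul ℝ ℝ, volume] g) :=
    hρc.continuous_convolution_left _ hρ hg.continuous.locallyIntegrable
  have he : ∀ y, ‖(moll ι hε ⋆[lsmul ℝ ℝ, volume] g) y - g y‖ ≤ ε * K := fun y ↦ by
    have h1 := norm_normed_convolution_sub_self_le (bump ι hε) hg (x := y) fun z _ ↦ hK z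
    rwa [bump_rOut] at h1
  have hsplit : moll2 hε g x - g x =
      (moll2 hε g x - (moll ι hε ⋆[lsmul ℝ ℝ, volume] g) x) + ((moll ι hε ⋆[lsmul ℝ ℝ, volume] g) x - g x) :=
    (sub_add_sub_cancel _ _ _).symm
  rw [hsplit]
  refine (norm_add_le _ _).trans ?_
  have h2 : ‖moll2 hε g x - (moll ι hε ⋆[lsmul ℝ ℝ, volume] g) x‖ ≤ ε * K := by
    have h3 : ‖(moll ι hε ⋆[lsmul ℝ ℝ, volume] fun y ↦ (moll ι hε ⋆[lsmul ℝ ℝ, volume] g) y - g y) x‖ ≤ ε * K :=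
      norm_normed_convolution_le (bump ι hε) (hJg.sub hg.continuous) fun z _ ↦ he z
    have h4 : (moll ι hε ⋆[lsmul ℝ ℝ, volume] fun y ↦ (moll ι hε ⋆[lsmul ℝ ℝ, volume] g) y - g y) x =
        moll2 hε g x - (moll ι hε ⋆[lsmul ℝ ℝ, volume] g) x := by
      rw [convolution_kernel_fun_sub hρ hρc hJg hg.continuous]
      rfl
    rw [h4] at h3
    exact h3
  linarith [he x]

omit [DecidableEq ι] [CompleteSpace W] in
/-- Double mollification is linear: `J²(f − g) = J²f − J²g`. [folklore] -/
theorem moll2_fun_sub {ε : ℝ} (hε : 0 < ε) {f g : EuclideanSpace ℝ ι → W} (hf : Continuous f) (hg : Continuous g) :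
    moll2 hε (fun x ↦ f x - g x) = fun x ↦ moll2 hε f x - moll2 hε g x := by
  have hρ := continuous_moll (ι := ι) hε
  have hρc := hasCompactSupport_moll (ι := ι) hε
  have hJf : Continuous (moll ι hε ⋆[lsmul ℝ ℝ, volume] f) := hρc.continuous_convolution_left _ hρ hf.locallyIntegrable
  have hJg : Continuous (moll ι hε ⋆[lsmul ℝ ℝ, volume] g) := hρc.continuous_convolution_left _ hρ hg.locallyIntegrable
  rw [moll2, convolution_kernel_fun_sub hρ hρc hf hg, convolution_kernel_fun_sub hρ hρc hJf hJg]
  rfl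

variable {A' : ι → EuclideanSpace ℝ ι → (W →L[ℝ] W)} {B' : EuclideanSpace ℝ ι → (W →L[ℝ] W)}

omit [DecidableEq ι] [CompleteSpace W] in
/-- **Pointwise bound for the word derivatives of `𝒫D`** through bounds for the coefficient word
derivatives and for the word derivatives of `D` one order up:
`‖∂_w(𝒫D)(y)‖ ≤ |splittings w| · M (n + 1) δ`. [cite: Friedrichs1954, §4] -/
theorem norm_cwd_foOp_le {k : ℕ} {M : ℝ} (hc : IsSymmCoeff k M A' B') {D : EuclideanSpace ℝ ι → W}
    (hD : ContDiff ℝ ∞ D) {δ : ℝ} (hδ : ∀ u : List ι, u.length ≤ k + 1 → ∀ y, ‖cwd u D y‖ ≤ δ)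
    {w : List ι} (hw : w.length ≤ k) (y : EuclideanSpace ℝ ι) :
    ‖cwd w (foOp A' B' D) y‖ ≤ (splittings w).length * (M * ((Fintype.card ι + 1) * δ)) := by
  rw [cwd_foOp hc.smoothA hc.smoothB hD w]
  have hM : 0 ≤ M := hc.nonneg
  have hterm : ∀ p ∈ splittings w,
      ‖foOp (fun j ↦ cwd p.1 (A' j)) (cwd p.1 B') (cwd p.2 D) y‖ ≤ M * ((Fintype.card ι + 1) * δ) := by
    intro p hp
    have hlen := length_add_length_of_mem_splittings hp
    have ha : p.1.length ≤ k := by omega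
    have hcl : p.2.length ≤ k := by omega
    rw [foOp_apply]
    refine (norm_add_le _ _).trans ?_
    have h1 : ‖∑ j, cwd p.1 (A' j) y (fderiv ℝ (cwd p.2 D) y (bv j))‖ ≤ ∑ _j : ι, M * δ := by
      refine (norm_sum_le _ _).trans (Finset.sum_le_sum fun j _ ↦ ?_)
      refine ((cwd p.1 (A' j) y).le_opNorm _).trans (mul_le_mul (hc.boundA j p.1 (by omega) y) ?_ (norm_nonneg _) hM)
      exact hδ (j :: p.2) (by simp; omega) y
    have h2 : ‖cwd p.1 B' y (cwd p.2 D y)‖ ≤ M * δ :=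
      ((cwd p.1 B' y).le_opNorm _).trans (mul_le_mul (hc.boundB p.1 ha y) (hδ p.2 (by omega) y) (norm_nonneg _) hM)
    rw [Finset.sum_const, Finset.card_univ, nsmul_eq_mul] at h1
    calc _ ≤ Fintype.card ι * (M * δ) + M * δ := add_le_add h1 h2
      _ = M * ((Fintype.card ι + 1) * δ) := by ring
  have hsum := norm_list_sum_le ((splittings w).map fun p ↦ foOp (fun j ↦ cwd p.1 (A' j)) (cwd p.1 B') (cwd p.2 D) y)
  refine hsum.trans ?_
  rw [List.map_map]
  have hle := List.sum_le_card_nsmul ((splittings w).map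
    ((fun z ↦ ‖z‖) ∘ fun p ↦ foOp (fun j ↦ cwd p.1 (A' j)) (cwd p.1 B') (cwd p.2 D) y)) (M * ((Fintype.card ι + 1) * δ))
    (fun r hr ↦ by
      obtain ⟨p, hp, rfl⟩ := List.mem_map.1 hr
      exact hterm p hp)
  rw [List.length_map, nsmul_eq_mul] at hle
  exact hle

end Tools

/-! ### The time derivative of the word derivatives of the approximating solutions -/

section Existence

variable (h : IsRegularSymmCoeffFamily A B) [FiniteDimensional ℝ W]
variable {U₀ : EuclideanSpace ℝ ι → W} (hU₀ : ContDiff ℝ ∞ U₀) (hU₀c : HasCompactSupport U₀)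

omit [DecidableEq ι] [FiniteDimensional ℝ W] in
/-- **The regularised equation differentiated in space**:
`∂ₜ ∂_wV_m(t)(x) = J_m² ∂_w(𝒫(t)V_m(t))(x)`. [cite: Friedrichs1954, §4] -/
theorem hasDerivAt_cwd_approx (m : ℕ) (w : List ι) (x : EuclideanSpace ℝ ι) (t : ℝ) :
    HasDerivAt (fun s ↦ cwd w (approx h hU₀ hU₀c m s) x)
      (moll2 (scale_pos m) (cwd w (foOp (fun j ↦ A j t) (B t) (approx h hU₀ hU₀c m t))) x) t := by
  have hε := scale_pos m
  have hρ : ContDiff ℝ ∞ (moll ι hε) := contDiff_moll hε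
  have hρc : HasCompactSupport (moll ι hε) := hasCompactSupport_moll hε
  set κ := cwd w (moll ι hε) with hκ
  have hκc : Continuous κ := (contDiff_cwd hρ w).continuous
  have hκs : HasCompactSupport κ := hasCompactSupport_cwd hρc w
  -- the curve as `evalL2 κ x ∘ Y_m`
  have hfun : (fun s ↦ cwd w (approx h hU₀ hU₀c m s) x) = fun s ↦ evalL2 κ hκc hκs x (approxSol h hU₀ hU₀c m s) := by
    funext s
    rw [approx_def, cwd_smoothRep hρ hρc, evalL2_apply, smoothRep]
  rw [hfun]
  have hd := (evalL2 (W := W) κ hκc hκs x).hasFDerivAt.comp_hasDerivAt t (approxSol_deriv h hU₀ hU₀c m t)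
  refine hd.congr_deriv ?_
  -- identify the value
  set P := foOp (fun j ↦ A j t) (B t) (approx h hU₀ hU₀c m t) with hP
  have hPs : ContDiff ℝ ∞ P := contDiff_foOp_smoothSol h hε _ t
  have hρP : LocallyIntegrable (moll ι hε ⋆[lsmul ℝ ℝ, volume] P) (volume : Measure (EuclideanSpace ℝ ι)) :=
    (hρc.continuous_convolution_left _ hρ.continuous hPs.continuous.locallyIntegrable).locallyIntegrable
  rw [evalL2_apply, convolution_kernel_congr_ae (coeFn_regField_apply h hε (approxSol h hU₀ hU₀c m) t), hκ]
  show (cwd w (moll ι hε) ⋆[lsmul ℝ ℝ, volume] (moll ι hε ⋆[lsmul ℝ ℝ, volume] P)) x = moll2 hε (cwd w P) x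
  rw [← cwd_convolution_eq_convolution_cwd_kernel hρ hρc hρP w]
  show cwd w (moll2 hε P) x = moll2 hε (cwd w P) x
  rw [cwd_moll2 hε hPs]

/-! ### Uniform constants over words of bounded length -/

/-- Uniform (in `u`, `|u| ≤ K`) sup bounds for the limit fields on `[−T, T]`. [cite: Friedrichs1954, §4] -/
theorem exists_norm_limField_le_unif (T : ℝ) (K : ℕ) :
    ∃ C, 0 ≤ C ∧ ∀ u : List ι, u.length ≤ K → ∀ t ∈ Icc (-T) T, ∀ x, ‖limField h hU₀ hU₀c u t x‖ ≤ C := by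
  choose C hC0 hC using fun u : List ι ↦ exists_norm_limField_le h hU₀ hU₀c T u
  refine ⟨∑ u ∈ wordsLE ι K, C u, Finset.sum_nonneg fun u _ ↦ hC0 u, fun u hu t ht x ↦ (hC u t ht x).trans ?_⟩
  exact Finset.single_le_sum (f := C) (fun u _ ↦ hC0 u) (mem_wordsLE.2 hu)

/-- Uniform (in `u`, `|u| ≤ K`) rates of convergence on `[−T, T]`. [cite: Friedrichs1954, §4] -/
theorem exists_norm_cwd_approx_sub_limField_le_unif (T : ℝ) (K : ℕ) :
    ∃ C, 0 ≤ C ∧ ∀ u : List ι, u.length ≤ K → ∀ m, ∀ t ∈ Icc (-T) T, ∀ x,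
      ‖cwd u (approx h hU₀ hU₀c m t) x - limField h hU₀ hU₀c u t x‖ ≤ C * scale m := by
  choose C hC0 hC using fun u : List ι ↦ exists_norm_cwd_approx_sub_limField_le h hU₀ hU₀c T u
  refine ⟨∑ u ∈ wordsLE ι K, C u, Finset.sum_nonneg fun u _ ↦ hC0 u, fun u hu m t ht x ↦ (hC u m t ht x).trans ?_⟩
  exact mul_le_mul_of_nonneg_right (Finset.single_le_sum (f := C) (fun u _ ↦ hC0 u) (mem_wordsLE.2 hu))
    (scale_pos m).le

/-! ### Uniform convergence of the time derivatives -/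

/-- **`J_m² ∂_w(𝒫V_m) → ∂_w(𝒫U)` uniformly on `[−T, T]`** (for fixed `x`), with rate `ε_m`.
[cite: Friedrichs1954, §4] -/
theorem exists_norm_deriv_approx_sub_le (T : ℝ) (w : List ι) (x : EuclideanSpace ℝ ι) :
    ∃ C, ∀ m, ∀ t ∈ Icc (-T) T,
      ‖moll2 (scale_pos m) (cwd w (foOp (fun j ↦ A j t) (B t) (approx h hU₀ hU₀c m t))) x -
        cwd w (foOp (fun j ↦ A j t) (B t) (limField h hU₀ hU₀c [] t)) x‖ ≤ C * scale m := by
  set k := w.length with hk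
  obtain ⟨M, hM⟩ := h.coeff T (k + 1)
  obtain ⟨C₁, -, hC₁⟩ := exists_norm_cwd_approx_sub_limField_le_unif h hU₀ hU₀c T (k + 1)
  obtain ⟨C₂, -, hC₂⟩ := exists_norm_limField_le_unif h hU₀ hU₀c T (k + 2)
  -- the gradient bound for `g = ∂_w 𝒫U(t)`
  set Kg : ℝ := ∑ j : ι, (splittings (j :: w)).length * (M * ((Fintype.card ι + 1) * C₂)) with hKg
  refine ⟨(splittings w).length * (M * ((Fintype.card ι + 1) * C₁)) + 2 * Kg, fun m t ht ↦ ?_⟩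
  have hε := scale_pos m
  set U : EuclideanSpace ℝ ι → W := limField h hU₀ hU₀c [] t with hU
  set V := approx h hU₀ hU₀c m t with hV
  have hUs : ContDiff ℝ ∞ U := contDiff_limField h hU₀ hU₀c [] t
  have hVs : ContDiff ℝ ∞ V := contDiff_approx h hU₀ hU₀c m t
  have hc : IsSymmCoeff (k + 1) M (fun j ↦ A j t) (B t) := hM t ht
  have hck : IsSymmCoeff k M (fun j ↦ A j t) (B t) := hc.mono (Nat.le_succ k)
  set P := foOp (fun j ↦ A j t) (B t) U with hP
  set Pm := foOp (fun j ↦ A j t) (B t) V with hPm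
  have hPs : ContDiff ℝ ∞ P :=
    (ContDiff.sum fun j _ ↦ (h.contDiff_A j t).clm_apply ((hUs.fderiv_right (m := ∞) le_rfl).clm_apply contDiff_const)).add
      ((h.contDiff_B t).clm_apply hUs)
  have hPms : ContDiff ℝ ∞ Pm := contDiff_foOp_smoothSol h hε _ t
  -- (i) `J²(g_m − g)`
  have hDiff : ∀ y, ‖cwd w Pm y - cwd w P y‖ ≤ (splittings w).length * (M * ((Fintype.card ι + 1) * (C₁ * scale m))) := by
    intro y
    have hD : ContDiff ℝ ∞ fun z ↦ V z - U z := hVs.sub hUs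
    have heq : cwd w Pm y - cwd w P y = cwd w (foOp (fun j ↦ A j t) (B t) fun z ↦ V z - U z) y := by
      rw [foOp_fun_sub (hVs.differentiable (by simp)) (hUs.differentiable (by simp)), ← hPm, ← hP,
        cwd_fun_sub hPms hPs]
    rw [heq]
    refine norm_cwd_foOp_le hck hD (fun u hu z ↦ ?_) le_rfl y
    rw [cwd_fun_sub hVs hUs]
    simp only
    rw [hU, cwd_limField, List.append_nil]
    exact hC₁ u hu m t ht z
  have h1 : ‖moll2 hε (cwd w Pm) x - moll2 hε (cwd w P) x‖ ≤
      (splittings w).length * (M * ((Fintype.card ι + 1) * (C₁ * scale m))) := by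
    have hsub := moll2_fun_sub hε (contDiff_cwd hPms w).continuous (contDiff_cwd hPs w).continuous
    have heq : moll2 hε (cwd w Pm) x - moll2 hε (cwd w P) x = moll2 hε (fun y ↦ cwd w Pm y - cwd w P y) x := by
      rw [hsub]
    rw [heq]
    exact norm_moll2_le hε ((contDiff_cwd hPms w).continuous.sub (contDiff_cwd hPs w).continuous) hDiff x
  -- (ii) `J²g − g`
  have hgrad : ∀ y, ‖fderiv ℝ (cwd w P) y‖ ≤ Kg := by
    intro y
    refine (opNorm_le_sum_norm_apply_bv _).trans (Finset.sum_le_sum fun j _ ↦ ?_)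
    show ‖cwd (j :: w) P y‖ ≤ _
    refine norm_cwd_foOp_le hc hUs (fun u hu z ↦ ?_) (by simp [hk]) y
    rw [hU, cwd_limField, List.append_nil]
    exact hC₂ u hu t ht z
  have h2 : ‖moll2 hε (cwd w P) x - cwd w P x‖ ≤ 2 * scale m * Kg :=
    norm_moll2_sub_self_le hε ((contDiff_cwd hPs w).of_le (by norm_num)) hgrad x
  -- combine
  calc ‖moll2 hε (cwd w Pm) x - cwd w P x‖
      ≤ ‖moll2 hε (cwd w Pm) x - moll2 hε (cwd w P) x‖ + ‖moll2 hε (cwd w P) x - cwd w P x‖ := norm_sub_le_norm_sub_add_norm_sub _ _ _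
    _ ≤ (splittings w).length * (M * ((Fintype.card ι + 1) * (C₁ * scale m))) + 2 * scale m * Kg := add_le_add h1 h2
    _ = ((splittings w).length * (M * ((Fintype.card ι + 1) * C₁)) + 2 * Kg) * scale m := by ring

/-! ### The time derivative of the limit -/

/-- **The word derivatives of the limit are differentiable in time with `∂ₜ∂_wU = ∂_w(𝒫U)`**
(uniform limits of the time derivatives of the `∂_wV_m`). [cite: Friedrichs1954, §4] -/
theorem hasDerivAt_limField (w : List ι) (x : EuclideanSpace ℝ ι) (t : ℝ) :
    HasDerivAt (fun s ↦ limField h hU₀ hU₀c w s x)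
      (cwd w (foOp (fun j ↦ A j t) (B t) (limField h hU₀ hU₀c [] t)) x) t := by
  set T := |t| + 1 with hT
  have htT : t ∈ Ioo (-T) T := ⟨by rw [hT]; linarith [neg_abs_le t], by rw [hT]; linarith [le_abs_self t]⟩
  obtain ⟨C, hC⟩ := exists_norm_deriv_approx_sub_le h hU₀ hU₀c T w x
  have hunif : TendstoUniformlyOn
      (fun m s ↦ moll2 (scale_pos m) (cwd w (foOp (fun j ↦ A j s) (B s) (approx h hU₀ hU₀c m s))) x)
      (fun s ↦ cwd w (foOp (fun j ↦ A j s) (B s) (limField h hU₀ hU₀c [] s)) x) atTop (Ioo (-T) T) := by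
    refine Metric.tendstoUniformlyOn_iff.2 fun ε hε ↦ ?_
    have hC0 : ∀ m, ∀ s ∈ Icc (-T) T, 0 ≤ C * scale m := fun m s hs ↦ (norm_nonneg _).trans (hC m s hs)
    have hev : ∀ᶠ m in atTop, |C| * scale m < ε := by
      have hl : Tendsto (fun m ↦ |C| * scale m) atTop (𝓝 0) := by simpa using tendsto_scale.const_mul |C|
      exact hl.eventually (gt_mem_nhds hε)
    filter_upwards [hev] with m hm s hs
    rw [dist_comm, dist_eq_norm]
    refine ((hC m s (Ioo_subset_Icc_self hs)).trans ?_).trans_lt hm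
    exact mul_le_mul_of_nonneg_right (le_abs_self C) (scale_pos m).le
  refine hasDerivAt_of_tendstoUniformlyOn isOpen_Ioo hunif
    (Eventually.of_forall fun m s _ ↦ hasDerivAt_cwd_approx h hU₀ hU₀c m w x s)
    (fun s _ ↦ tendsto_limField h hU₀ hU₀c w s x) htT

/-- **The initial value of the limit**: `U(0) = U₀` (`ρ_m ⋆ U₀ → U₀`). [cite: Friedrichs1954, §4] -/
theorem limField_nil_zero : limField h hU₀ hU₀c [] 0 = U₀ := by
  funext x
  have hlim := tendsto_limField h hU₀ hU₀c [] 0 x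
  -- the approximations at time `0` are `ρ_m ⋆ U₀`
  have happ : ∀ m, cwd [] (approx h hU₀ hU₀c m 0) x = (moll ι (scale_pos m) ⋆[lsmul ℝ ℝ, volume] U₀) x := by
    intro m
    rw [cwd_nil, approx_def, approxSol_zero, smoothRep, convolution_kernel_congr_ae (MemLp.coeFn_toLp _)]
  obtain ⟨K, hK⟩ := (hU₀.continuous_fderiv (by simp)).bounded_above_of_compact_support (hU₀c.fderiv (𝕜 := ℝ))
  have hconv : Tendsto (fun m ↦ cwd [] (approx h hU₀ hU₀c m 0) x) atTop (𝓝 (U₀ x)) := by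
    rw [tendsto_iff_norm_sub_tendsto_zero]
    have hb : ∀ m, ‖cwd [] (approx h hU₀ hU₀c m 0) x - U₀ x‖ ≤ scale m * K := fun m ↦ by
      rw [happ m]
      have h1 := norm_normed_convolution_sub_self_le (bump ι (scale_pos m)) (hU₀.of_le (by norm_num)) (x := x)
        fun y _ ↦ hK y
      rwa [bump_rOut] at h1
    have hl : Tendsto (fun m ↦ scale m * K) atTop (𝓝 0) := by simpa using tendsto_scale.mul_const K
    exact squeeze_zero (fun m ↦ norm_nonneg _) hb hl
  exact tendsto_nhds_unique hlim hconv

/-- **Friedrichs' existence theorem for linear symmetric hyperbolic systems (smooth data of compact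
support, global in time)**: for a regular admissible family of coefficients
(`IsRegularSymmCoeffFamily`: smooth, `Aⱼ` pointwise symmetric, word derivatives bounded locally
uniformly in time, jointly smooth, locally Lipschitz in time) and `U₀ ∈ C_c^∞(ℝⁿ; W)`, `W` a
finite-dimensional real inner product space, there is `U ∈ C^∞(ℝ × ℝⁿ; W)` with `U(0) = U₀` and
`∂ₜU(t, x) = Σⱼ Aⱼ(t, x) ∂ⱼU(t, x) + B(t, x) U(t, x)` for all `(t, x)`.
[cite: Friedrichs1954, Thm. 4.1 with §§3–4; Alinhac2009, §7.6 Thm. 7.11; TaylorPDEIII2011, Ch. 16 Prop. 1.4–1.5] -/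
theorem exists_smooth_solution (h : IsRegularSymmCoeffFamily A B) (hU₀ : ContDiff ℝ ∞ U₀) (hU₀c : HasCompactSupport U₀) :
    ∃ U : ℝ → EuclideanSpace ℝ ι → W, U 0 = U₀ ∧
      ContDiff ℝ ∞ (fun p : ℝ × EuclideanSpace ℝ ι ↦ U p.1 p.2) ∧ (∀ t, ContDiff ℝ ∞ (U t)) ∧
      ∀ t x, HasDerivAt (fun s ↦ U s x) (foOp (fun j ↦ A j t) (B t) (U t) x) t := by
  set U : ℝ → EuclideanSpace ℝ ι → W := fun t ↦ limField h hU₀ hU₀c [] t with hU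
  have hUs : ∀ t, ContDiff ℝ ∞ (U t) := fun t ↦ contDiff_limField h hU₀ hU₀c [] t
  have hcwd : ∀ (v : List ι) (t : ℝ), cwd v (U t) = limField h hU₀ hU₀c v t := fun v t ↦ by
    show cwd v (limField h hU₀ hU₀c [] t) = _
    rw [cwd_limField, List.append_nil]
  have hUc : ∀ v : List ι, Continuous fun p : ℝ × EuclideanSpace ℝ ι ↦ cwd v (U p.1) p.2 := fun v ↦ by
    have heq : (fun p : ℝ × EuclideanSpace ℝ ι ↦ cwd v (U p.1) p.2) = fun p ↦ limField h hU₀ hU₀c v p.1 p.2 := by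
      funext p; rw [hcwd]
    rw [heq]
    exact continuous_limField h hU₀ hU₀c v
  have hUd : ∀ (v : List ι) (t : ℝ) (x : EuclideanSpace ℝ ι),
      HasDerivAt (fun s ↦ cwd v (U s) x) (cwd v (foOp (fun j ↦ A j t) (B t) (U t)) x) t := fun v t x ↦ by
    have heq : (fun s ↦ cwd v (U s) x) = fun s ↦ limField h hU₀ hU₀c v s x := by funext s; rw [hcwd]
    rw [heq]
    exact hasDerivAt_limField h hU₀ hU₀c v x t
  refine ⟨U, limField_nil_zero h hU₀ hU₀c, contDiff_uncurry_of_classical hUs hUc hUd h.jointA h.jointB, hUs,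
    fun t x ↦ ?_⟩
  simpa [cwd_nil] using hUd [] t x

end Existence

end Literature.Analysis.PDE

end
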